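import Literature.MathematicalPhysics.QuantumFieldTheory.Balaban1983to89.Node00.HistoryTermDatum214LocalGrowthAnalytic
import Literature.Analysis.Complex.HolomorphicBanach

/-!
# NODE 00 (YM-PLAN Track A) — W1 = [II] §2 (2.13)–(2.14), STOREY 17d: THE WILSON REMAINDER AS THE THIRD-ORDER REMAINDER OF AN ANALYTIC
# LOCALIZED ACTION READING IN THE COMPLEXIFIED UNSCALED FIELD (the generic 2-jet ∕ third-order remainder `W1.Jet3.dropConst ∕ lin₁C ∕ dropAffine ∕
# quad₂C ∕ jet₂C ∕ rem₃C` with its parametric faces; the object `W1.TermDatum214.LocActionC`, `LocActionC.wilsonC`, `LocActionC.actionJetC`, the laws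
# `JointHoloOn ∕ FieldHoloOn ∕ CfgHoloOn ∕ SupBoundOn ∕ LocalInC ∕ RealSliceMeasurable`, the letter `wilsonSupBound`, the datum-level reading `readWilsonC`,
# the schema `WilsonOfActionOn`)

NODE 00 DEFINER MODULE (seat `pub-ymgap-node00-def-W1`, generation 27, 2026-08-27).  APPEND-ONLY: a NEW importing module; g15's
`Node00/HistoryTermDatum214LocalGrowthAnalytic` (storey 12b: `ComplexWilson`, `realSliceWilson`, `UnscaledWilson`), dag-n10-c's `B13Lemma2LeadingParts`
(module 48: `ofRealVec`, `homPart_smul`, `realSlice_measurable_homPart`, `linPart`, `cubicPart`, `beginsAt_three`), b2b's `B13ExpansionOrder` (`slice`,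
`BeginsAt`, `homPart`, `rem`, `beginsAt_one`, `beginsAt_two`, `norm_homPart_le`, `norm_rem_le`, `orderGe_slice_rem`, `homPart_one`, `homPart_two_eq`) and
lit-balaban's `Literature.Analysis.Complex.HolomorphicBanach` ([Chae1985] Thm 14.13 on ANY complex normed domain: `differentiableOn_fderiv`,
`fderiv_fderiv_apply`, `analyticOnNhd_of_differentiableOn`) untouched and CONSUMED BY NAME.  Typed on the pub-ymgap bus for the by-name ask «W1-17d» of seat
`pub-ymgap-dag-n22-c` g10 (2026-08-27 22:58Z; record `SliceInputsL2U` p578863, whose WILSON half of Lemma 2's sentence — `Wc : 𝔇.ComplexWilson`, `h𝒲re`,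
`hWd`, `hWM`, `hWB` with the letter `M𝒲`, and the real-slice laws `h𝒲m`, `h𝒲d`, `hlocY𝒲` — «would be dischargeable like J20 if W1 types the Wilson remainder
as the THIRD-ORDER REMAINDER of an analytic localized action functional … `Wc ξ Y := 𝒜c ξ Y − jet₂(𝒜c ξ Y)`, laws (analytic + sup-bounded on `ball 0 RA`
uniformly on W; Y-locality; φ-holomorphy; measurability), faces `BeginsAt (Wc ξ Y) 3` and `hWM` from the sup bound of `𝒜c` by the Cauchy estimates of the
jet»).

## What this storey types, and why

[I] (2.6)–(2.8) p. 266 expand the action under the exponential of the fluctuation integral (2.1), at the configuration moved by the fluctuation field,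
in the field `H₁B′`: «Denoting terms of at least third order in H₁B′ by V(H₁B′) we get  A(U_{k+1}) + ⟨H₁B′, J⟩ + ½⟨H₁B′, Δ₁H₁B′⟩ + V(H₁B′). (2.8)»;
[II] p. 10 ll. 9–11, 15–31 localize `V`: «The function V is given by the formula (80) (ref. 15), which comes from the expansion (41) (ref. 15) of the Wilson action
… an analytic function on the space U^c_k × …  The function V can have a natural localization connected with the sum over plaquettes in the Wilson action
… V(H₁B′) = Σ_□ V_□(H₁B′) (1.37) … Now we apply the decomposition (1.10) to each term … The term corresponding to a domain Y is represented as (1.38).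
The above expression is localized in the interior of Y, with respect to U, J, B′ or B. It is an analytic function of (U, J) in the space U^c_k × (…),
and of B′ in the domain {B′ : e^{16κ₁}|B′| ≤ a₁ on Y}», with «|(1.38)| ≤ C₃(e^{16κ₁}|B′|)³M⁴exp(−(κ₁−1)M⁻⁴|Y∖□|) (1.39)»; the configurations are moved by
the complexified field as in [I] (3.10) p. 272.  So print's Wilson remainder, PER LOCALIZATION DOMAIN, is «the terms of at least third order» of an
analytic function of (configuration, complex field) — and its two located sizes in the N22 record, the third-order ONSET `BeginsAt (𝒲ᶜ Y) 3` and the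
SUP LETTER `M𝒲(Y)` on the ball, are then CONSEQUENCES of one sup letter `M𝒜(Y)` of that analytic function by the Cauchy estimates of its 2-jet.

This storey types exactly that, in two layers.
(§1–§2, namespace `W1.Jet3`, generic over a complex normed `E` and a complete `F`.)  The 2-jet at `0` and the third-order remainder of `f : E → F` by
SUCCESSIVE PEELING with the tree's engine `B13ExpansionOrder.homPart` (the order-`n` homogeneous part read off the complex slices): `dropConst f :=
f − f 0` (begins at order 1), `lin₁C f := homPart (dropConst f) 1` (`= Df(0)`, `lin₁C_eq_fderiv`), `dropAffine f := dropConst f − lin₁C f` (begins at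
order 2), `quad₂C f := homPart (dropAffine f) 2` (`= ½D²f(0)(w,w)`, `quad₂C_eq_fderiv_fderiv`), `jet₂C f := f 0 + lin₁C f + quad₂C f`, `rem₃C f :=
dropAffine f − quad₂C f` (`= f − jet₂C f`, `rem₃C_eq`).  From `DifferentiableOn ℂ f (ball 0 R)` and a sup bound `M` ALONE: ★ `beginsAt_rem₃C :
BeginsAt (rem₃C f) 3` (module 48's homogeneity `homPart_smul` + `orderGe_slice_rem`) and ★ `norm_rem₃C_le : ‖rem₃C f w‖ ≤ 8M(‖w‖∕R)³` (`norm_rem_le`;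
`2M`, `4M` are the sup letters of `dropConst f`, `dropAffine f`); the jet is ENTIRE (`differentiable_jet₂C`) so `rem₃C f` is complex-differentiable
wherever `f` is (`differentiableOn_rem₃C`); bond locality passes to every piece (`rem₃C_local`); real-slice measurability needs only measurability of
the real slice of `f` (`measurable_rem₃C_realSlice`, module 48 `realSlice_measurable_homPart`).  §2: for a JOINTLY complex-differentiable two-variable
map `(x, z) ↦ g x z` on an open `W ×ˢ V ∋ (·, 0)` the jet pieces and the remainder at a fixed field are complex-differentiable IN THE PARAMETER `x` on
`W` (`differentiableOn_param_lin₁C ∕ _quad₂C ∕ _rem₃C`) — the second derivative of the joint map is holomorphic by `HolomorphicBanach.differentiableOn_fderiv`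
applied twice (dimension-free; the parameter here is a configuration in a Banach space).  Joint, not separate, holomorphy is the law: separate ⇒ joint
(Hartogs) is not in Mathlib ∕ the tree for Banach parameters, and print's functions ARE jointly analytic in (U, J, B′).
(§3–§6, namespace `W1.TermDatum214`.)  The object `LocActionC Z t := CPair P 𝔸 → TDom → (Λ → ℂ) → ℂ` — the Y-localized term of the effective action
read in the complexified unscaled field, `𝒜ᶜ_{Z,t}(ξ; Y, z)`, a BARE FUNCTION TYPE (hypothesis-schema: nothing of Bałaban's (2.6) ∕ (1.38) is
constructed); `LocActionC.wilsonC 𝒜 ξ Y := rem₃C (𝒜 ξ Y)` (print's `V(Y; ·)`) and `actionJetC` with (2.8) as the identity `𝒜 = actionJetC 𝒜 + wilsonC 𝒜`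
(`actionJetC_add_wilsonC`); the LAWS as displayed `Prop`s (`JointHoloOn W 𝔅c`; its consequences `FieldHoloOn` ∕ `CfgHoloOn`; `SupBoundOn W RA M𝒜` — the sup of
the analytic function on the polydisc, the constant behind (1.39); `LocalInC W S` — «localized in the interior of Y»; `RealSliceMeasurable W`); the honesty
witness `0`; the letter `wilsonSupBound M𝒜 Y := 8·M𝒜 Y` with its sign; the SLICE-LEVEL FACES in the shapes of the record's Wilson block (`beginsAt_wilsonC` =
`hWB`, `norm_wilsonC_le` = `hWM` with `M𝒲 := wilsonSupBound M𝒜`, `differentiableOn_wilsonC_ball` = `hWd`, `differentiableOn_wilsonC_config_realSlice` = `h𝒲d`,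
`measurable_wilsonC_realSlice` = `h𝒲m`, `wilsonC_local_realSlice` = `hlocY𝒲`); the datum-level reading `readWilsonC 𝒜c : 𝔇.ComplexWilson` with
`realSliceWilson (readWilsonC 𝒜c) Z t ξ Y A = readWilsonC 𝒜c Z t ξ Y (A ↪ ℂ)` (`rfl` — the record's `h𝒲re` for the read pair); and the hypothesis schema
`WilsonOfActionOn Wc Z t 𝒜 W 𝔅c` on an OPAQUE `Wc : 𝔇.ComplexWilson` («the function V is given by … the expansion … of the Wilson action») with the transfer
faces `WilsonOfActionOn.beginsAt ∕ norm_le ∕ differentiableOn_ball ∕ differentiableOn_config_realSlice ∕ measurable_realSlice ∕ local_realSlice ∕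
realSlice_apply` — the record's `hWB hWM hWd h𝒲d h𝒲m hlocY𝒲 h𝒲re` binder for binder for a consumer holding the schema on a field set `𝔅c ⊇ ball 0 R_A`.

The complex field set `𝔅c : Set (Λ → ℂ)` of the laws is a binder: analyticity in the field is asked ON `𝔅c`, the sup letter on `ball 0 R_A ⊆ 𝔅c`; the
consumer who must meet the ALL-REAL-FIELD quantifiers of the N22 record (`h𝒲d` at every real `A`) instantiates `𝔅c := univ` («entire in the field») or
any open `𝔅c` containing every real field (`h𝔅 : ∀ A, ofRealVec A ∈ 𝔅c`) — a producer clamping outside the analyticity ball (storey 17's remark) keeps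
joint analyticity on `W ×ˢ univ` by composing with an entire retraction, or delivers `h𝒲d` on the real slice by other means; the laws are split so that
each face asks only what it uses.

REMARK (not typed, not over-claimed).  `quad₂C (𝒜 ξ Y)` is (2.8)'s quadratic term `½⟨H₁B′, Δ₁H₁B′⟩` localized in `Y`; the QUADRATIC FORM of Lemma 2
(1.42) is a DIFFERENT object — the second-order expansion of `V(Y; ·)` itself «with B′ replaced by tB′» ((1.40) p. 10) — and is not read here.

HONEST LIMITS.  Hypothesis-schema style: an OBJECT and its laws, NOTHING asserted of print's data; the PRODUCER (NODE A at the record) owes an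
inhabitant `𝒜c` WITH the laws at the datum of record — joint analyticity on `W ×ˢ 𝔅c`, the sup letter `M𝒜(Y)` on the ball (whose decay in `|Y∖□|`,
(1.39), is whatever the producer's letter carries, not a theorem of this file), locality, real-slice measurability; N22 is NOT discharged here; no
estimate of print ((1.39)–(1.40), (1.43), [I] (2.6)–(2.11)) is claimed or re-proved.  What IS proved is elementary complex analysis: the Cauchy
estimates of the 2-jet and the third-order Schwarz bound of the remainder, on any complex Banach space.

## CITATION HEADER (D-0065)
- [I] = T. Bałaban, Renormalization group approach to lattice gauge field theories. I. Generation of effective actions in a small field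
  approximation and a coupling constant renormalization in four dimensions, Comm. Math. Phys. 109 (1987) 249–301 [Balaban1987RG1]: §2 (2.1) p. 265,
  (2.4)–(2.9) p. 266 ll. 4–32 (quoted: ll. 28–30, (2.8)), (2.10)–(2.11) p. 267; (3.10), (3.13)–(3.14) p. 272.
- [II] = T. Bałaban, Renormalization group approach to lattice gauge field theories. II. Cluster expansions, Comm. Math. Phys. 116 (1988) 1–22
  [Balaban1988RG2Cluster]: p. 10 ll. 9–13 (V from the expansion of the Wilson action), (1.37)–(1.38) ll. 15–31 (localization, analyticity domain),
  (1.39)–(1.40) ll. 33–41; Lemma 2 (1.41)–(1.43) p. 11 ll. 14–26; (1.34) p. 9.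
- [Chae1985] S. B. Chae, Holomorphy and Calculus in Normed Spaces (1985), Thm 14.13 — through `Literature.Analysis.Complex.HolomorphicBanach` (by name).
- Pages were read from the materialised texts `paper:balaban1987-cmp109-rg-i-small-field` pp. 265–267, 272 (journal pagination; PDF pp. 17–19, 24)
  and `paper:balaban1988-cmp116-rg-ii-cluster` pp. 9–11.

Typer lint: no `instance`, no `notation`, no attribute removal, no `sorry`; one file for one source section (the third-order remainder behind
[I] (2.8) ∕ [II] (1.37)–(1.39) and its reading at the term datum).
-/

open scoped BigOperators Topology

noncomputable section

namespace Literature.MathematicalPhysics.QuantumFieldTheory.Balaban1983to89.Node00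

open Metric Set Filter
open _root_.MeasureTheory
open Literature.MathematicalPhysics.QuantumFieldTheory.Balaban1983to89
open Literature.MathematicalPhysics.QuantumFieldTheory.Balaban1983to89.B11SchwarzRemainder (OrderGe)
open Literature.MathematicalPhysics.QuantumFieldTheory.Balaban1983to89.B13ExpansionOrder
open Literature.MathematicalPhysics.QuantumFieldTheory.Balaban1983to89.B13Lemma2LeadingParts (ofRealVec ofRealVec_apply ofRealVec_zero
  continuous_ofRealVec homPart_smul realSlice_measurable_homPart linPart cubicPart wilsonR)
open Literature.Analysis.Complex (HolomorphicBanach.differentiableOn_fderiv HolomorphicBanach.fderiv_fderiv_apply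
  HolomorphicBanach.analyticOnNhd_of_differentiableOn)

namespace W1

/-! ## §1  Generic: the 2-jet at `0` and the third-order remainder of a map of complex Banach spaces, by successive peeling -/

namespace Jet3

variable {E F : Type*} [NormedAddCommGroup E] [NormedSpace ℂ E] [NormedAddCommGroup F] [NormedSpace ℂ F]

/-- **`f − f(0)`** — the map with its constant term peeled off ([I] (2.8): the term `A(U_{k+1})` removed). It begins at order 1.
[cite: Balaban1987RG1, (2.8) p.266] (elementary complex analysis for Lemma 2's expansion) -/
def dropConst (f : E → F) (w : E) : F :=
  f w - f 0

/-- **THE LINEAR TERM `Df(0)·w`**, read off the complex slices as the order-1 homogeneous part of `f − f(0)` (`B13ExpansionOrder.homPart`; equal to the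
Fréchet differential, `lin₁C_eq_fderiv`) — (2.8)'s `⟨H₁B′, J⟩`. [cite: Balaban1987RG1, (2.8) p.266] (elementary complex analysis for Lemma 2's expansion) -/
def lin₁C (f : E → F) (w : E) : F :=
  homPart (dropConst f) 1 w

/-- **`f − f(0) − Df(0)`** — the map with its affine part peeled off. It begins at order 2 («the terms of zeroth and first order vanish», [II] p.10 l.36).
[cite: Balaban1987RG1, (2.8) p.266; Balaban1988RG2Cluster, p.10 l.36] (elementary complex analysis for Lemma 2's expansion) -/
def dropAffine (f : E → F) (w : E) : F :=
  dropConst f w - lin₁C f w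

/-- **THE QUADRATIC TERM `½D²f(0)(w,w)`**, read off the complex slices as the order-2 homogeneous part of `f − f(0) − Df(0)` (equal to half the second
Fréchet differential on the diagonal for analytic `f`, `quad₂C_eq_fderiv_fderiv`) — (2.8)'s `½⟨H₁B′, Δ₁H₁B′⟩`.
[cite: Balaban1987RG1, (2.7)-(2.8) p.266] (elementary complex analysis for Lemma 2's expansion) -/
def quad₂C (f : E → F) (w : E) : F :=
  homPart (dropAffine f) 2 w

/-- **THE 2-JET `f(0) + Df(0)·w + ½D²f(0)(w,w)`** — (2.8)'s displayed part `A(U_{k+1}) + ⟨H₁B′, J⟩ + ½⟨H₁B′, Δ₁H₁B′⟩`.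
[cite: Balaban1987RG1, (2.8) p.266] (elementary complex analysis for Lemma 2's expansion) -/
def jet₂C (f : E → F) (w : E) : F :=
  f 0 + lin₁C f w + quad₂C f w

/-- **THE THIRD-ORDER REMAINDER `f − jet₂C f`** (`rem₃C_eq`) — (2.8)'s `V`: «Denoting terms of at least third order in H₁B′ by V(H₁B′)»; it BEGINS AT ORDER
THREE (`beginsAt_rem₃C`) with the cubic Schwarz bound `norm_rem₃C_le`. [cite: Balaban1987RG1, (2.8) p.266; Balaban1988RG2Cluster, (1.38)-(1.39) p.10] (elementary complex analysis for Lemma 2's expansion) -/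
def rem₃C (f : E → F) (w : E) : F :=
  dropAffine f w - quad₂C f w

/-! ### §1.1  Algebra of the peeling -/

omit [NormedSpace ℂ E] [NormedSpace ℂ F] in
/-- `dropConst f w = f w − f 0` (`rfl`). [cite: Balaban1987RG1, (2.8) p.266 (bookkeeping)] -/
@[simp] theorem dropConst_apply (f : E → F) (w : E) : dropConst f w = f w - f 0 := rfl

/-- `dropAffine f w = f w − f 0 − lin₁C f w` (`rfl`). [cite: Balaban1987RG1, (2.8) p.266 (bookkeeping)] -/
theorem dropAffine_apply (f : E → F) (w : E) : dropAffine f w = f w - f 0 - lin₁C f w := rfl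

/-- `rem₃C f w = f w − f 0 − lin₁C f w − quad₂C f w` (`rfl`). [cite: Balaban1987RG1, (2.8) p.266 (bookkeeping)] -/
theorem rem₃C_apply (f : E → F) (w : E) : rem₃C f w = f w - f 0 - lin₁C f w - quad₂C f w := rfl

/-- `lin₁C f = homPart (dropConst f) 1` (`rfl`). [cite: Balaban1987RG1, (2.8) p.266 (bookkeeping)] -/
theorem lin₁C_eq_homPart (f : E → F) : lin₁C f = homPart (dropConst f) 1 := rfl

/-- `quad₂C f = homPart (dropAffine f) 2` (`rfl`). [cite: Balaban1987RG1, (2.8) p.266 (bookkeeping)] -/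
theorem quad₂C_eq_homPart (f : E → F) : quad₂C f = homPart (dropAffine f) 2 := rfl

/-- The third-order remainder IS `B13ExpansionOrder.rem` of the affine-peeled map after its quadratic part (`rfl`) — so every face of the tree's
remainder applies to it by name. [cite: Balaban1987RG1, (2.8) p.266 and (2.12) p.268 (bookkeeping)] -/
theorem rem₃C_eq_rem (f : E → F) : rem₃C f = rem (dropAffine f) 2 := rfl

/-- **(2.8) AS AN IDENTITY**: `f w = jet₂C f w + rem₃C f w`. [cite: Balaban1987RG1, (2.8) p.266] (elementary complex analysis for Lemma 2's expansion) -/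
theorem jet₂C_add_rem₃C (f : E → F) (w : E) : jet₂C f w + rem₃C f w = f w := by
  simp only [jet₂C, rem₃C, dropAffine, dropConst]
  abel

/-- `rem₃C f w = f w − jet₂C f w` — the ask's «`Wc ξ Y := 𝒜c ξ Y − jet₂(𝒜c ξ Y)`». [cite: Balaban1987RG1, (2.8) p.266] (elementary complex analysis for Lemma 2's expansion) -/
theorem rem₃C_eq (f : E → F) (w : E) : rem₃C f w = f w - jet₂C f w := by
  rw [← jet₂C_add_rem₃C f w, add_sub_cancel_left]

omit [NormedSpace ℂ E] [NormedSpace ℂ F] in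
/-- `dropConst f 0 = 0`. [cite: Balaban1987RG1, (2.8) p.266 (bookkeeping)] -/
@[simp] theorem dropConst_zero (f : E → F) : dropConst f 0 = 0 := sub_self _

/-- `lin₁C f 0 = 0`. [cite: Balaban1987RG1, (2.8) p.266 (bookkeeping)] -/
@[simp] theorem lin₁C_zero (f : E → F) : lin₁C f 0 = 0 := homPart_zero_right (dropConst_zero f) 0

/-- `dropAffine f 0 = 0`. [cite: Balaban1987RG1, (2.8) p.266 (bookkeeping)] -/
@[simp] theorem dropAffine_zero (f : E → F) : dropAffine f 0 = 0 := by
  rw [dropAffine, dropConst_zero, lin₁C_zero, sub_zero]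

/-- `quad₂C f 0 = 0`. [cite: Balaban1987RG1, (2.8) p.266 (bookkeeping)] -/
@[simp] theorem quad₂C_zero (f : E → F) : quad₂C f 0 = 0 := homPart_zero_right (dropAffine_zero f) 1

/-- `rem₃C f 0 = 0`. [cite: Balaban1987RG1, (2.8) p.266 (bookkeeping)] -/
@[simp] theorem rem₃C_zero (f : E → F) : rem₃C f 0 = 0 := by
  rw [rem₃C, dropAffine_zero, quad₂C_zero, sub_zero]

/-- `jet₂C f 0 = f 0`. [cite: Balaban1987RG1, (2.8) p.266 (bookkeeping)] -/
@[simp] theorem jet₂C_zero (f : E → F) : jet₂C f 0 = f 0 := by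
  rw [jet₂C, lin₁C_zero, quad₂C_zero, add_zero, add_zero]

/-- The homogeneous parts of the zero map vanish. [cite: Balaban1987RG1, (2.8) p.266 (degenerate instance)] -/
theorem homPart_zero_fun (n : ℕ) (w : E) : homPart (0 : E → F) n w = 0 := by
  have hs : slice (0 : E → F) w = 0 := by
    funext t
    simp [slice]
  unfold homPart B11SchwarzRemainder.leadCoeff
  rw [hs, tail_zero_fun]
  rfl

omit [NormedSpace ℂ E] [NormedSpace ℂ F] in
/-- Honesty: `dropConst 0 = 0`. [cite: Balaban1987RG1, (2.8) p.266 (degenerate instance)] -/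
@[simp] theorem dropConst_zero_fun : dropConst (0 : E → F) = 0 := by
  funext w
  simp [dropConst]

/-- Honesty: `lin₁C 0 = 0`. [cite: Balaban1987RG1, (2.8) p.266 (degenerate instance)] -/
@[simp] theorem lin₁C_zero_fun : lin₁C (0 : E → F) = 0 := by
  funext w
  rw [lin₁C, dropConst_zero_fun, homPart_zero_fun]
  rfl

/-- Honesty: `dropAffine 0 = 0`. [cite: Balaban1987RG1, (2.8) p.266 (degenerate instance)] -/
@[simp] theorem dropAffine_zero_fun : dropAffine (0 : E → F) = 0 := by
  funext w
  rw [dropAffine, dropConst_zero_fun, lin₁C_zero_fun]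
  simp

/-- Honesty: `quad₂C 0 = 0`. [cite: Balaban1987RG1, (2.8) p.266 (degenerate instance)] -/
@[simp] theorem quad₂C_zero_fun : quad₂C (0 : E → F) = 0 := by
  funext w
  rw [quad₂C, dropAffine_zero_fun, homPart_zero_fun]
  rfl

/-- Honesty: `rem₃C 0 = 0` — the zero action has zero Wilson remainder. [cite: Balaban1987RG1, (2.8) p.266 (degenerate instance)] -/
@[simp] theorem rem₃C_zero_fun : rem₃C (0 : E → F) = 0 := by
  funext w
  rw [rem₃C, dropAffine_zero_fun, quad₂C_zero_fun]
  simp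

/-- Module 48 consistency: its real-slice linear part `linPart Oc A` IS `lin₁C Oc (A ↪ ℂ)` (`rfl`). [cite: Balaban1988RG2Cluster, Lemma 2 (1.42) p.11 (bookkeeping)] -/
theorem linPart_eq_lin₁C {Λ : Type*} [Fintype Λ] (Oc : (Λ → ℂ) → ℂ) (A : Λ → ℝ) : linPart Oc A = lin₁C Oc (ofRealVec A) := rfl

/-! ### §1.2  Orders and Cauchy bounds of the pieces, from holomorphy and a sup bound on a ball alone -/

section Quantitative

variable [CompleteSpace F] {f : E → F} {R M : ℝ}

omit [CompleteSpace F] in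
/-- `f − f(0)` is complex-differentiable wherever `f` is. [cite: Balaban1987RG1, (2.8) p.266 (bookkeeping)] -/
theorem differentiableOn_dropConst {s : Set E} (hf : DifferentiableOn ℂ f s) : DifferentiableOn ℂ (dropConst f) s :=
  hf.sub_const (f 0)

omit [NormedSpace ℂ E] [NormedSpace ℂ F] [CompleteSpace F] in
/-- Sup letter of `f − f(0)` on the ball: `2M`. [cite: Balaban1987RG1, (2.8) p.266] (elementary complex analysis for Lemma 2's expansion) -/
theorem norm_dropConst_le (hR : 0 < R) (hM : ∀ z ∈ ball (0 : E) R, ‖f z‖ ≤ M) :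
    ∀ z ∈ ball (0 : E) R, ‖dropConst f z‖ ≤ 2 * M := fun z hz => by
  have h1 := hM z hz
  have h2 := hM 0 (mem_ball_self hR)
  calc ‖dropConst f z‖ ≤ ‖f z‖ + ‖f 0‖ := norm_sub_le _ _
    _ ≤ M + M := add_le_add h1 h2
    _ = 2 * M := by ring

/-- `f − f(0)` begins at order 1 (`B13ExpansionOrder.beginsAt_one`). [cite: Balaban1987RG1, (2.8) p.266] (elementary complex analysis for Lemma 2's expansion) -/
theorem beginsAt_dropConst (hR : 0 < R) (hf : DifferentiableOn ℂ f (ball 0 R)) : BeginsAt (dropConst f) 1 :=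
  beginsAt_one hR (differentiableOn_dropConst hf) (dropConst_zero f)

omit [CompleteSpace F] in
/-- **THE LINEAR TERM IS THE DIFFERENTIAL**: `lin₁C f w = Df(0) w` (`B13ExpansionOrder.homPart_one`). [cite: Balaban1987RG1, (2.8) p.266] (elementary complex analysis for Lemma 2's expansion) -/
theorem lin₁C_eq_fderiv (hf : DifferentiableAt ℂ f 0) (w : E) : lin₁C f w = fderiv ℂ f 0 w := by
  have h1 : DifferentiableAt ℂ (dropConst f) 0 := hf.sub_const (f 0)
  have e : dropConst f = fun y => f y - f 0 := rfl
  rw [lin₁C, homPart_one h1, e, fderiv_sub_const]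

omit [CompleteSpace F] in
/-- The linear term as a map IS the continuous linear map `Df(0)`. [cite: Balaban1987RG1, (2.8) p.266] (elementary complex analysis for Lemma 2's expansion) -/
theorem lin₁C_eq_fderiv' (hf : DifferentiableAt ℂ f 0) : lin₁C f = ⇑(fderiv ℂ f 0) :=
  funext (lin₁C_eq_fderiv hf)

omit [CompleteSpace F] in
/-- The linear term is an ENTIRE map (a continuous linear one). [cite: Balaban1987RG1, (2.8) p.266] (elementary complex analysis for Lemma 2's expansion) -/
theorem differentiable_lin₁C (hf : DifferentiableAt ℂ f 0) : Differentiable ℂ (lin₁C f) := by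
  rw [lin₁C_eq_fderiv' hf]
  exact (fderiv ℂ f 0).differentiable

omit [CompleteSpace F] in
/-- The linear term is continuous. [cite: Balaban1987RG1, (2.8) p.266] (elementary complex analysis for Lemma 2's expansion) -/
theorem continuous_lin₁C (hf : DifferentiableAt ℂ f 0) : Continuous (lin₁C f) := by
  rw [lin₁C_eq_fderiv' hf]
  exact (fderiv ℂ f 0).continuous

omit [CompleteSpace F] in
/-- A map complex-differentiable on a ball of positive radius about `0` is differentiable at `0`. [cite: Balaban1988RG2Cluster, (1.34) p.9 (bookkeeping)] -/
theorem differentiableAt_zero_of_ball (hR : 0 < R) (hf : DifferentiableOn ℂ f (ball 0 R)) : DifferentiableAt ℂ f 0 :=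
  hf.differentiableAt (ball_mem_nhds _ hR)

/-- **CAUCHY BOUND ON THE LINEAR TERM**: `‖Df(0) w‖ ≤ 2M·‖w‖∕R` on the ball. [cite: Balaban1987RG1, (2.8) p.266; Balaban1988RG2Cluster, (1.39)-(1.40) p.10] (elementary complex analysis for Lemma 2's expansion) -/
theorem norm_lin₁C_le (hR : 0 < R) (hf : DifferentiableOn ℂ f (ball 0 R)) (hM : ∀ z ∈ ball (0 : E) R, ‖f z‖ ≤ M)
    {w : E} (hw : w ∈ ball (0 : E) R) : ‖lin₁C f w‖ ≤ 2 * M * (‖w‖ / R) := by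
  have h := norm_homPart_le (n := 1) (differentiableOn_dropConst hf) (norm_dropConst_le hR hM) (beginsAt_dropConst hR hf) hw
  rw [pow_one] at h
  exact h

omit [CompleteSpace F] in
/-- `f − f(0) − Df(0)` is complex-differentiable wherever `f` is (given differentiability at `0`). [cite: Balaban1987RG1, (2.8) p.266 (bookkeeping)] -/
theorem differentiableOn_dropAffine {s : Set E} (hf : DifferentiableOn ℂ f s) (h0 : DifferentiableAt ℂ f 0) :
    DifferentiableOn ℂ (dropAffine f) s :=
  (differentiableOn_dropConst hf).sub (differentiable_lin₁C h0).differentiableOn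

/-- Sup letter of `f − f(0) − Df(0)` on the ball: `4M`. [cite: Balaban1987RG1, (2.8) p.266; Balaban1988RG2Cluster, (1.39) p.10] (elementary complex analysis for Lemma 2's expansion) -/
theorem norm_dropAffine_le (hR : 0 < R) (hf : DifferentiableOn ℂ f (ball 0 R)) (hM : ∀ z ∈ ball (0 : E) R, ‖f z‖ ≤ M) :
    ∀ z ∈ ball (0 : E) R, ‖dropAffine f z‖ ≤ 4 * M := fun z hz => by
  have h1 := norm_dropConst_le hR hM z hz
  have h2 := norm_lin₁C_le hR hf hM hz
  have hM0 : 0 ≤ M := (norm_nonneg _).trans (hM 0 (mem_ball_self hR))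
  have hz1 : ‖z‖ / R ≤ 1 := (div_le_one hR).2 (mem_ball_zero_iff.1 hz).le
  calc ‖dropAffine f z‖ ≤ ‖dropConst f z‖ + ‖lin₁C f z‖ := norm_sub_le _ _
    _ ≤ 2 * M + 2 * M * (‖z‖ / R) := add_le_add h1 h2
    _ ≤ 2 * M + 2 * M * 1 := by gcongr
    _ = 4 * M := by ring

omit [CompleteSpace F] in
/-- The differential of `f − f(0) − Df(0)` at a point of differentiability: `Df(x) − Df(0)`. [cite: Balaban1987RG1, (2.8) p.266 (bookkeeping)] -/
theorem hasFDerivAt_dropAffine {x : E} (hx : DifferentiableAt ℂ f x) (h0 : DifferentiableAt ℂ f 0) :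
    HasFDerivAt (dropAffine f) (fderiv ℂ f x - fderiv ℂ f 0) x := by
  have h1 : HasFDerivAt (dropConst f) (fderiv ℂ f x) x := hx.hasFDerivAt.sub_const (f 0)
  have h2 : HasFDerivAt (lin₁C f) (fderiv ℂ f 0) x := by
    rw [lin₁C_eq_fderiv' h0]
    exact (fderiv ℂ f 0).hasFDerivAt
  exact h1.sub h2

omit [CompleteSpace F] in
/-- `D(f − f(0) − Df(0))(x) = Df(x) − Df(0)`. [cite: Balaban1987RG1, (2.8) p.266 (bookkeeping)] -/
theorem fderiv_dropAffine {x : E} (hx : DifferentiableAt ℂ f x) (h0 : DifferentiableAt ℂ f 0) :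
    fderiv ℂ (dropAffine f) x = fderiv ℂ f x - fderiv ℂ f 0 :=
  (hasFDerivAt_dropAffine hx h0).fderiv

omit [CompleteSpace F] in
/-- «The terms of zeroth and first order vanish»: `D(f − f(0) − Df(0))(0) = 0`. [cite: Balaban1988RG2Cluster, p.10 l.36] (elementary complex analysis for Lemma 2's expansion) -/
theorem fderiv_dropAffine_zero (h0 : DifferentiableAt ℂ f 0) : fderiv ℂ (dropAffine f) 0 = 0 := by
  rw [fderiv_dropAffine h0 h0, sub_self]

/-- `f − f(0) − Df(0)` BEGINS AT ORDER 2 (`B13ExpansionOrder.beginsAt_two`). [cite: Balaban1988RG2Cluster, p.10 l.36; Balaban1987RG1, (2.8) p.266] (elementary complex analysis for Lemma 2's expansion) -/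
theorem beginsAt_dropAffine (hR : 0 < R) (hf : DifferentiableOn ℂ f (ball 0 R)) : BeginsAt (dropAffine f) 2 :=
  beginsAt_two hR (differentiableOn_dropAffine hf (differentiableAt_zero_of_ball hR hf)) (dropAffine_zero f)
    (fderiv_dropAffine_zero (differentiableAt_zero_of_ball hR hf))

/-- **THE QUADRATIC TERM IS 2-HOMOGENEOUS** along complex lines: `quad₂C f (c•w) = c²•quad₂C f w` (module 48 `homPart_smul`).
[cite: Balaban1987RG1, (2.7)-(2.8) p.266; Balaban1988RG2Cluster, (1.40) p.10] (elementary complex analysis for Lemma 2's expansion) -/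
theorem quad₂C_smul (hR : 0 < R) (hf : DifferentiableOn ℂ f (ball 0 R)) (hM : ∀ z ∈ ball (0 : E) R, ‖f z‖ ≤ M) (c : ℂ) (w : E) :
    quad₂C f (c • w) = c ^ 2 • quad₂C f w :=
  homPart_smul hR (differentiableOn_dropAffine hf (differentiableAt_zero_of_ball hR hf)) (norm_dropAffine_le hR hf hM)
    (beginsAt_dropAffine hR hf) c w

/-- **CAUCHY BOUND ON THE QUADRATIC TERM**: `‖½D²f(0)(w,w)‖ ≤ 4M(‖w‖∕R)²` on the ball. [cite: Balaban1988RG2Cluster, (1.40) p.10; Balaban1987RG1, (2.8) p.266] (elementary complex analysis for Lemma 2's expansion) -/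
theorem norm_quad₂C_le (hR : 0 < R) (hf : DifferentiableOn ℂ f (ball 0 R)) (hM : ∀ z ∈ ball (0 : E) R, ‖f z‖ ≤ M)
    {w : E} (hw : w ∈ ball (0 : E) R) : ‖quad₂C f w‖ ≤ 4 * M * (‖w‖ / R) ^ 2 :=
  norm_homPart_le (differentiableOn_dropAffine hf (differentiableAt_zero_of_ball hR hf)) (norm_dropAffine_le hR hf hM)
    (beginsAt_dropAffine hR hf) hw

/-- **★ THE REMAINDER BEGINS AT ORDER THREE** — [I] (2.8) «terms of at least third order in H₁B′» as the THEOREM `BeginsAt (rem₃C f) 3`, from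
holomorphy on a ball and a sup bound alone: along each complex line the remainder is `(f − f(0) − Df(0))(t•w) − t²·quad₂C f w = O(t³)`
(`B13ExpansionOrder.orderGe_slice_rem` and the homogeneity `quad₂C_smul`). [cite: Balaban1987RG1, (2.8) p.266; Balaban1988RG2Cluster, (1.38)-(1.39) p.10] (elementary complex analysis for Lemma 2's expansion) -/
theorem beginsAt_rem₃C (hR : 0 < R) (hf : DifferentiableOn ℂ f (ball 0 R)) (hM : ∀ z ∈ ball (0 : E) R, ‖f z‖ ≤ M) :
    BeginsAt (rem₃C f) 3 := fun w => by
  have h := orderGe_slice_rem hR (differentiableOn_dropAffine hf (differentiableAt_zero_of_ball hR hf)) (norm_dropAffine_le hR hf hM)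
    (beginsAt_dropAffine hR hf) w
  have e : slice (rem₃C f) w = fun t : ℂ => dropAffine f (t • w) - t ^ 2 • homPart (dropAffine f) 2 w := by
    funext t
    rw [slice_apply, rem₃C, quad₂C_smul hR hf hM t w, quad₂C_eq_homPart]
  rw [e]
  exact h

/-- **★ THE CUBIC SCHWARZ BOUND OF THE REMAINDER**: `‖rem₃C f w‖ ≤ 8M(‖w‖∕R)³` on the ball (`B13ExpansionOrder.norm_rem_le` for the affine-peeled map,
sup letter `4M`) — the shape of (1.39)'s `C₃(e^{16κ₁}|B′|)³·(…)`. [cite: Balaban1988RG2Cluster, (1.39) p.10; Balaban1987RG1, (2.8) p.266] (elementary complex analysis for Lemma 2's expansion) -/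
theorem norm_rem₃C_le (hR : 0 < R) (hf : DifferentiableOn ℂ f (ball 0 R)) (hM : ∀ z ∈ ball (0 : E) R, ‖f z‖ ≤ M) :
    ∀ w ∈ ball (0 : E) R, ‖rem₃C f w‖ ≤ 8 * M * (‖w‖ / R) ^ 3 := fun w hw => by
  have h := norm_rem_le (n := 2) (differentiableOn_dropAffine hf (differentiableAt_zero_of_ball hR hf)) (norm_dropAffine_le hR hf hM)
    (beginsAt_dropAffine hR hf) hw
  rw [rem₃C_eq_rem]
  calc ‖rem (dropAffine f) 2 w‖ ≤ 2 * (4 * M) * (‖w‖ / R) ^ (2 + 1) := h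
    _ = 8 * M * (‖w‖ / R) ^ 3 := by ring

/-- **THE SUP LETTER OF THE REMAINDER ON THE BALL**: `‖rem₃C f w‖ ≤ 8M` (the record's `hWM` shape, letter `8M`). [cite: Balaban1988RG2Cluster, (1.39) p.10; Balaban1987RG1, (2.8) p.266] (elementary complex analysis for Lemma 2's expansion) -/
theorem norm_rem₃C_le_const (hR : 0 < R) (hf : DifferentiableOn ℂ f (ball 0 R)) (hM : ∀ z ∈ ball (0 : E) R, ‖f z‖ ≤ M) :
    ∀ w ∈ ball (0 : E) R, ‖rem₃C f w‖ ≤ 8 * M := fun w hw => by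
  have hM0 : 0 ≤ M := (norm_nonneg _).trans (hM 0 (mem_ball_self hR))
  have hw1 : ‖w‖ / R ≤ 1 := (div_le_one hR).2 (mem_ball_zero_iff.1 hw).le
  have hw0 : 0 ≤ ‖w‖ / R := div_nonneg (norm_nonneg w) hR.le
  calc ‖rem₃C f w‖ ≤ 8 * M * (‖w‖ / R) ^ 3 := norm_rem₃C_le hR hf hM w hw
    _ ≤ 8 * M * 1 := by gcongr; exact pow_le_one₀ hw0 hw1
    _ = 8 * M := by ring

omit [NormedSpace ℂ E] [NormedSpace ℂ F] [CompleteSpace F] in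
/-- A sup bound on a ball about `0` is nonnegative. [cite: Balaban1988RG2Cluster, (1.39) p.10 (bookkeeping)] -/
theorem nonneg_of_bound (hR : 0 < R) (hM : ∀ z ∈ ball (0 : E) R, ‖f z‖ ≤ M) : 0 ≤ M :=
  (norm_nonneg _).trans (hM 0 (mem_ball_self hR))

/-! ### §1.3  The analytic faces: the quadratic term is half the second differential; the jet is entire; the remainder is holomorphic where `f` is -/

variable {U : Set E}

/-- **THE QUADRATIC TERM IS HALF THE SECOND DIFFERENTIAL ON THE DIAGONAL**: `quad₂C f w = ½·D²f(0) w w` for `f` complex-differentiable on an open set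
about `0` (analytic there by [Chae1985] 14.13, `HolomorphicBanach.analyticOnNhd_of_differentiableOn`; then `B13ExpansionOrder.homPart_two_eq` and
`HolomorphicBanach.fderiv_fderiv_apply`). [cite: Balaban1987RG1, (2.7)-(2.8) p.266; Balaban1988RG2Cluster, (1.40) p.10] (elementary complex analysis for Lemma 2's expansion) -/
theorem quad₂C_eq_fderiv_fderiv (hf : DifferentiableOn ℂ f U) (hU : IsOpen U) (h0U : (0 : E) ∈ U) (w : E) :
    quad₂C f w = (2 : ℂ)⁻¹ • fderiv ℂ (fderiv ℂ f) 0 w w := by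
  obtain ⟨R, hR, hRU⟩ := Metric.isOpen_iff.1 hU 0 h0U
  have h0 : DifferentiableAt ℂ f 0 := hf.differentiableAt (hU.mem_nhds h0U)
  have hdA : DifferentiableOn ℂ (dropAffine f) U := differentiableOn_dropAffine hf h0
  have han : AnalyticOnNhd ℂ (dropAffine f) (ball 0 R) :=
    (HolomorphicBanach.analyticOnNhd_of_differentiableOn hdA hU).mono hRU
  rw [quad₂C, homPart_two_eq hR han w]
  congr 1
  have hev : (fun z => fderiv ℂ (dropAffine f) z w) =ᶠ[𝓝 (0 : E)] fun z => fderiv ℂ f z w - fderiv ℂ f 0 w := by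
    filter_upwards [hU.mem_nhds h0U] with z hz
    rw [fderiv_dropAffine (hf.differentiableAt (hU.mem_nhds hz)) h0, _root_.sub_apply]
  rw [hev.fderiv_eq, fderiv_sub_const, HolomorphicBanach.fderiv_fderiv_apply hf hU h0U w w]

/-- The quadratic term as a map: `w ↦ ½·D²f(0) w w`. [cite: Balaban1987RG1, (2.7)-(2.8) p.266] (elementary complex analysis for Lemma 2's expansion) -/
theorem quad₂C_eq_fderiv_fderiv' (hf : DifferentiableOn ℂ f U) (hU : IsOpen U) (h0U : (0 : E) ∈ U) :
    quad₂C f = fun w => (2 : ℂ)⁻¹ • fderiv ℂ (fderiv ℂ f) 0 w w :=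
  funext (quad₂C_eq_fderiv_fderiv hf hU h0U)

/-- The quadratic term is an ENTIRE map (a continuous quadratic form). [cite: Balaban1987RG1, (2.7)-(2.8) p.266] (elementary complex analysis for Lemma 2's expansion) -/
theorem differentiable_quad₂C (hf : DifferentiableOn ℂ f U) (hU : IsOpen U) (h0U : (0 : E) ∈ U) : Differentiable ℂ (quad₂C f) := by
  rw [quad₂C_eq_fderiv_fderiv' hf hU h0U]
  exact (((fderiv ℂ (fderiv ℂ f) 0).differentiable).clm_apply differentiable_id).const_smul _

/-- The quadratic term is continuous. [cite: Balaban1987RG1, (2.7)-(2.8) p.266] (elementary complex analysis for Lemma 2's expansion) -/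
theorem continuous_quad₂C (hf : DifferentiableOn ℂ f U) (hU : IsOpen U) (h0U : (0 : E) ∈ U) : Continuous (quad₂C f) :=
  (differentiable_quad₂C hf hU h0U).continuous

/-- **THE 2-JET IS ENTIRE** (constant + linear + quadratic). [cite: Balaban1987RG1, (2.8) p.266] (elementary complex analysis for Lemma 2's expansion) -/
theorem differentiable_jet₂C (hf : DifferentiableOn ℂ f U) (hU : IsOpen U) (h0U : (0 : E) ∈ U) : Differentiable ℂ (jet₂C f) := by
  have h0 : DifferentiableAt ℂ f 0 := hf.differentiableAt (hU.mem_nhds h0U)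
  show Differentiable ℂ fun w => f 0 + lin₁C f w + quad₂C f w
  exact ((differentiable_const _).add (differentiable_lin₁C h0)).add (differentiable_quad₂C hf hU h0U)

/-- **THE REMAINDER IS COMPLEX-DIFFERENTIABLE WHEREVER `f` IS** (on an open set about `0`) — Lemma 2's «analytic function … of B′ in the domain …» for
`V(Y; ·)` (the record's `hWd` shape). [cite: Balaban1988RG2Cluster, p.10 ll.30-31 and Lemma 2 (1.41) p.11; Balaban1987RG1, (2.8) p.266] (elementary complex analysis for Lemma 2's expansion) -/
theorem differentiableOn_rem₃C (hf : DifferentiableOn ℂ f U) (hU : IsOpen U) (h0U : (0 : E) ∈ U) : DifferentiableOn ℂ (rem₃C f) U :=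
  (differentiableOn_dropAffine hf (hf.differentiableAt (hU.mem_nhds h0U))).sub (differentiable_quad₂C hf hU h0U).differentiableOn

/-- The remainder is complex-differentiable on every subset of the open set of holomorphy of `f` (e.g. the ball `‖w‖ < R_A`). [cite: Balaban1988RG2Cluster, Lemma 2 (1.41) p.11; Balaban1987RG1, (2.8) p.266] (elementary complex analysis for Lemma 2's expansion) -/
theorem differentiableOn_rem₃C_of_subset (hf : DifferentiableOn ℂ f U) (hU : IsOpen U) (h0U : (0 : E) ∈ U) {s : Set E} (hs : s ⊆ U) :
    DifferentiableOn ℂ (rem₃C f) s :=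
  (differentiableOn_rem₃C hf hU h0U).mono hs

/-- The remainder is continuous on the open set of holomorphy of `f`. [cite: Balaban1988RG2Cluster, Lemma 2 (1.41) p.11 (bookkeeping)] -/
theorem continuousOn_rem₃C (hf : DifferentiableOn ℂ f U) (hU : IsOpen U) (h0U : (0 : E) ∈ U) : ContinuousOn (rem₃C f) U :=
  (differentiableOn_rem₃C hf hU h0U).continuousOn

end Quantitative

/-! ### §1.4  Transport of the onset along maps agreeing near `0` -/

section Congr

variable {f g : E → F} {n : ℕ}

omit [NormedSpace ℂ F] in
/-- `OrderGe` is invariant under eventual equality on the punctured neighbourhood of `0`. [cite: Balaban1987RG1, (2.8) p.266 (bookkeeping)] -/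
theorem orderGe_of_eventuallyEq {φ ψ : ℂ → F} (hφψ : φ =ᶠ[𝓝[≠] (0 : ℂ)] ψ) (hψ : OrderGe ψ n) : OrderGe φ n := by
  obtain ⟨C, hC⟩ := hψ
  exact ⟨C, (hφψ.and hC).mono fun t ht => by rw [ht.1]; exact ht.2⟩

omit [NormedSpace ℂ F] in
/-- **`BeginsAt` passes along maps agreeing near `0`**: if `f = g` on a neighbourhood of `0` and `g` begins at order `n`, so does `f` (the onset is a
germ property) — the transfer of `hWB` through the schema `WilsonOfActionOn`. [cite: Balaban1987RG1, (2.8) p.266 (bookkeeping)] -/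
theorem beginsAt_of_eventuallyEq (hfg : f =ᶠ[𝓝 (0 : E)] g) (hg : BeginsAt g n) : BeginsAt f n := fun w => by
  have ht : Tendsto (fun t : ℂ => t • w) (𝓝 0) (𝓝 0) := by
    simpa only [zero_smul, id_eq] using (Filter.tendsto_id : Tendsto (fun t : ℂ => t) (𝓝 0) (𝓝 0)).smul_const w
  have hev : slice f w =ᶠ[𝓝[≠] (0 : ℂ)] slice g w := (ht.eventually hfg).filter_mono nhdsWithin_le_nhds
  exact orderGe_of_eventuallyEq hev (hg w)

omit [NormedSpace ℂ F] in
/-- `BeginsAt` passes along maps agreeing on an open set about `0`. [cite: Balaban1987RG1, (2.8) p.266 (bookkeeping)] -/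
theorem beginsAt_of_eqOn {V : Set E} (hV : IsOpen V) (h0 : (0 : E) ∈ V) (hfg : EqOn f g V) (hg : BeginsAt g n) : BeginsAt f n :=
  beginsAt_of_eventuallyEq (hfg.eventuallyEq_of_mem (hV.mem_nhds h0)) hg

end Congr

/-! ### §1.5  Bond locality of the pieces (field space `Λ → ℂ`) -/

section Local

variable {Λ : Type*} [Fintype Λ] {f : (Λ → ℂ) → F} (S : Finset Λ)

omit [NormedAddCommGroup F] [NormedSpace ℂ F] in
/-- Slices through fields agreeing on the bond set `S` coincide, for an `S`-local map. [cite: Balaban1988RG2Cluster, p.10 l.29 and (1.34) p.9 (bookkeeping)] -/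
theorem slice_congr_of_local (hloc : ∀ z z' : Λ → ℂ, (∀ b ∈ S, z b = z' b) → f z = f z') {w w' : Λ → ℂ}
    (hw : ∀ b ∈ S, w b = w' b) : slice f w = slice f w' :=
  funext fun t => hloc _ _ fun b hb => by simp only [Pi.smul_apply, hw b hb]

/-- The homogeneous parts of an `S`-local map are `S`-local. [cite: Balaban1988RG2Cluster, p.10 l.29 and (1.34) p.9 (bookkeeping)] -/
theorem homPart_local (hloc : ∀ z z' : Λ → ℂ, (∀ b ∈ S, z b = z' b) → f z = f z') (n : ℕ) :
    ∀ w w' : Λ → ℂ, (∀ b ∈ S, w b = w' b) → homPart f n w = homPart f n w' := fun w w' hw => by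
  unfold homPart
  rw [slice_congr_of_local S hloc hw]

omit [NormedSpace ℂ F] in
/-- `f − f(0)` is `S`-local if `f` is. [cite: Balaban1988RG2Cluster, p.10 l.29 (bookkeeping)] -/
theorem dropConst_local (hloc : ∀ z z' : Λ → ℂ, (∀ b ∈ S, z b = z' b) → f z = f z') :
    ∀ z z' : Λ → ℂ, (∀ b ∈ S, z b = z' b) → dropConst f z = dropConst f z' := fun z z' hz => by
  rw [dropConst_apply, dropConst_apply, hloc z z' hz]

/-- The linear term is `S`-local if `f` is. [cite: Balaban1988RG2Cluster, p.10 l.29 (bookkeeping)] -/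
theorem lin₁C_local (hloc : ∀ z z' : Λ → ℂ, (∀ b ∈ S, z b = z' b) → f z = f z') :
    ∀ z z' : Λ → ℂ, (∀ b ∈ S, z b = z' b) → lin₁C f z = lin₁C f z' :=
  homPart_local S (dropConst_local S hloc) 1

/-- `f − f(0) − Df(0)` is `S`-local if `f` is. [cite: Balaban1988RG2Cluster, p.10 l.29 (bookkeeping)] -/
theorem dropAffine_local (hloc : ∀ z z' : Λ → ℂ, (∀ b ∈ S, z b = z' b) → f z = f z') :
    ∀ z z' : Λ → ℂ, (∀ b ∈ S, z b = z' b) → dropAffine f z = dropAffine f z' := fun z z' hz => by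
  rw [dropAffine, dropAffine, dropConst_local S hloc z z' hz, lin₁C_local S hloc z z' hz]

/-- The quadratic term is `S`-local if `f` is. [cite: Balaban1988RG2Cluster, p.10 l.29 (bookkeeping)] -/
theorem quad₂C_local (hloc : ∀ z z' : Λ → ℂ, (∀ b ∈ S, z b = z' b) → f z = f z') :
    ∀ z z' : Λ → ℂ, (∀ b ∈ S, z b = z' b) → quad₂C f z = quad₂C f z' :=
  homPart_local S (dropAffine_local S hloc) 2

/-- The 2-jet is `S`-local if `f` is. [cite: Balaban1988RG2Cluster, p.10 l.29 (bookkeeping)] -/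
theorem jet₂C_local (hloc : ∀ z z' : Λ → ℂ, (∀ b ∈ S, z b = z' b) → f z = f z') :
    ∀ z z' : Λ → ℂ, (∀ b ∈ S, z b = z' b) → jet₂C f z = jet₂C f z' := fun z z' hz => by
  rw [jet₂C, jet₂C, lin₁C_local S hloc z z' hz, quad₂C_local S hloc z z' hz]

/-- **THE REMAINDER IS `S`-LOCAL IF `f` IS** («localized in the interior of Y, with respect to … B′», the record's `hlocY𝒲` shape).
[cite: Balaban1988RG2Cluster, p.10 l.29 and (1.34) p.9] (elementary complex analysis for Lemma 2's expansion) -/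
theorem rem₃C_local (hloc : ∀ z z' : Λ → ℂ, (∀ b ∈ S, z b = z' b) → f z = f z') :
    ∀ z z' : Λ → ℂ, (∀ b ∈ S, z b = z' b) → rem₃C f z = rem₃C f z' := fun z z' hz => by
  rw [rem₃C, rem₃C, dropAffine_local S hloc z z' hz, quad₂C_local S hloc z z' hz]

/-- The remainder is `S`-local on REAL fields if `f` is `S`-local. [cite: Balaban1988RG2Cluster, p.10 l.29 and (1.34) p.9 (bookkeeping)] -/
theorem rem₃C_local_realSlice (hloc : ∀ z z' : Λ → ℂ, (∀ b ∈ S, z b = z' b) → f z = f z') :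
    ∀ A A' : Λ → ℝ, (∀ b ∈ S, A b = A' b) → rem₃C f (ofRealVec A) = rem₃C f (ofRealVec A') := fun A A' hA =>
  rem₃C_local S hloc _ _ fun b hb => by rw [ofRealVec_apply, ofRealVec_apply, hA b hb]

end Local

/-! ### §1.6  Measurability and continuity of the real slices (field space `Λ → ℂ`, scalar values) -/

section RealSlice

variable {Λ : Type*} [Fintype Λ] {f : (Λ → ℂ) → ℂ} {R M : ℝ}

/-- The real slice of the linear term is measurable if the real slice of `f` is (module 48 `realSlice_measurable_homPart`, `n = 0`).
[cite: Balaban1988RG2Cluster, Lemma 2 (1.41) p.11 (bookkeeping)] -/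
theorem measurable_lin₁C_realSlice (hR : 0 < R) (hf : DifferentiableOn ℂ f (ball 0 R)) (hM : ∀ z ∈ ball (0 : Λ → ℂ) R, ‖f z‖ ≤ M)
    (hfm : Measurable fun A : Λ → ℝ => f (ofRealVec A)) : Measurable fun A : Λ → ℝ => lin₁C f (ofRealVec A) :=
  realSlice_measurable_homPart (n := 0) hR (differentiableOn_dropConst hf) (norm_dropConst_le hR hM) (beginsAt_dropConst hR hf)
    (hfm.sub_const (f 0))

/-- The real slice of `f − f(0) − Df(0)` is measurable if the real slice of `f` is. [cite: Balaban1988RG2Cluster, Lemma 2 (1.41) p.11 (bookkeeping)] -/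
theorem measurable_dropAffine_realSlice (hR : 0 < R) (hf : DifferentiableOn ℂ f (ball 0 R)) (hM : ∀ z ∈ ball (0 : Λ → ℂ) R, ‖f z‖ ≤ M)
    (hfm : Measurable fun A : Λ → ℝ => f (ofRealVec A)) : Measurable fun A : Λ → ℝ => dropAffine f (ofRealVec A) :=
  (hfm.sub_const (f 0)).sub (measurable_lin₁C_realSlice hR hf hM hfm)

/-- The real slice of the quadratic term is measurable if the real slice of `f` is (module 48 `realSlice_measurable_homPart`, `n = 1`).
[cite: Balaban1988RG2Cluster, Lemma 2 (1.41) p.11 (bookkeeping)] -/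
theorem measurable_quad₂C_realSlice (hR : 0 < R) (hf : DifferentiableOn ℂ f (ball 0 R)) (hM : ∀ z ∈ ball (0 : Λ → ℂ) R, ‖f z‖ ≤ M)
    (hfm : Measurable fun A : Λ → ℝ => f (ofRealVec A)) : Measurable fun A : Λ → ℝ => quad₂C f (ofRealVec A) :=
  realSlice_measurable_homPart (n := 1) hR (differentiableOn_dropAffine hf (differentiableAt_zero_of_ball hR hf))
    (norm_dropAffine_le hR hf hM) (beginsAt_dropAffine hR hf) (measurable_dropAffine_realSlice hR hf hM hfm)

/-- **THE REAL SLICE OF THE REMAINDER IS MEASURABLE** if the real slice of `f` is (the record's `h𝒲m` shape; no continuity asked).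
[cite: Balaban1988RG2Cluster, Lemma 2 (1.41) p.11; Balaban1987RG1, (2.8) p.266] (elementary complex analysis for Lemma 2's expansion) -/
theorem measurable_rem₃C_realSlice (hR : 0 < R) (hf : DifferentiableOn ℂ f (ball 0 R)) (hM : ∀ z ∈ ball (0 : Λ → ℂ) R, ‖f z‖ ≤ M)
    (hfm : Measurable fun A : Λ → ℝ => f (ofRealVec A)) : Measurable fun A : Λ → ℝ => rem₃C f (ofRealVec A) :=
  (measurable_dropAffine_realSlice hR hf hM hfm).sub (measurable_quad₂C_realSlice hR hf hM hfm)

/-- The real slice of the remainder is CONTINUOUS when `f` is holomorphic on an open field set containing every real field.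
[cite: Balaban1988RG2Cluster, Lemma 2 (1.41) p.11 (bookkeeping)] -/
theorem continuous_rem₃C_realSlice {U : Set (Λ → ℂ)} (hf : DifferentiableOn ℂ f U) (hU : IsOpen U) (hA : ∀ A : Λ → ℝ, ofRealVec A ∈ U) :
    Continuous fun A : Λ → ℝ => rem₃C f (ofRealVec A) := by
  have h0 : (0 : Λ → ℂ) ∈ U := by simpa [ofRealVec_zero] using hA 0
  exact (continuousOn_rem₃C hf hU h0).comp_continuous continuous_ofRealVec hA

/-- The real slice of the remainder is measurable when `f` is holomorphic on an open field set containing every real field (continuity route).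
[cite: Balaban1988RG2Cluster, Lemma 2 (1.41) p.11 (bookkeeping)] -/
theorem measurable_rem₃C_realSlice_of_holo {U : Set (Λ → ℂ)} (hf : DifferentiableOn ℂ f U) (hU : IsOpen U)
    (hA : ∀ A : Λ → ℝ, ofRealVec A ∈ U) : Measurable fun A : Λ → ℝ => rem₃C f (ofRealVec A) :=
  (continuous_rem₃C_realSlice hf hU hA).measurable

end RealSlice

/-! ## §2  Generic parametric faces: the jet pieces and the remainder of a JOINTLY holomorphic two-variable map are holomorphic in the parameter -/

section Param

variable {X : Type*} [NormedAddCommGroup X] [NormedSpace ℂ X] [CompleteSpace F]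
variable {g : X → E → F} {W : Set X} {V : Set E}

omit [CompleteSpace F] in
/-- **CHAIN RULE IN THE SECOND VARIABLE**: the differential of `z ↦ g x z` at `z` is the joint differential at `(x, z)` applied to `(0, ·)`.
[cite: Balaban1988RG2Cluster, p.10 ll.30-31 (bookkeeping: partial versus joint differentials in (U, J, B′)); Chae1985, Thm 14.13] -/
theorem fderiv_curry_right_apply {x : X} {z : E} (hG : DifferentiableAt ℂ (fun p : X × E => g p.1 p.2) (x, z)) (w : E) :
    fderiv ℂ (g x) z w = fderiv ℂ (fun p : X × E => g p.1 p.2) (x, z) (0, w) := by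
  have h1 : HasFDerivAt (fun z' : E => (x, z')) (ContinuousLinearMap.inr ℂ X E) z := hasFDerivAt_prodMk_right x z
  have h2 : HasFDerivAt (g x) ((fderiv ℂ (fun p : X × E => g p.1 p.2) (x, z)).comp (ContinuousLinearMap.inr ℂ X E)) z :=
    hG.hasFDerivAt.comp z h1
  rw [h2.fderiv, ContinuousLinearMap.comp_apply, ContinuousLinearMap.inr_apply]

omit [CompleteSpace F] in
/-- Joint holomorphy gives holomorphy IN THE PARAMETER at each fixed second variable. [cite: Balaban1988RG2Cluster, p.10 ll.30-31 (bookkeeping: joint analyticity in (U, J, B′) gives separate analyticity)] -/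
theorem differentiableOn_param_apply (hG : DifferentiableOn ℂ (fun p : X × E => g p.1 p.2) (W ×ˢ V)) {z : E} (hz : z ∈ V) :
    DifferentiableOn ℂ (fun x => g x z) W :=
  hG.comp (differentiableOn_id.prodMk (differentiableOn_const z)) fun _ hx => mk_mem_prod hx hz

omit [CompleteSpace F] in
/-- Joint holomorphy gives holomorphy IN THE SECOND VARIABLE at each fixed parameter. [cite: Balaban1988RG2Cluster, p.10 ll.30-31 (bookkeeping: joint analyticity in (U, J, B′) gives separate analyticity)] -/
theorem differentiableOn_of_joint (hG : DifferentiableOn ℂ (fun p : X × E => g p.1 p.2) (W ×ˢ V)) {x : X} (hx : x ∈ W) :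
    DifferentiableOn ℂ (g x) V :=
  hG.comp ((differentiableOn_const x).prodMk differentiableOn_id) fun _ hz => mk_mem_prod hx hz

/-- **THE DIRECTIONAL DERIVATIVE IN THE SECOND VARIABLE IS HOLOMORPHIC IN THE PARAMETER**: `x ↦ D(g x)(z) w` is complex-differentiable on `W`
(the joint differential is holomorphic, [Chae1985] 14.13 via `HolomorphicBanach.differentiableOn_fderiv`). [cite: Chae1985, Thm 14.13] -/
theorem differentiableOn_param_fderiv_apply (hG : DifferentiableOn ℂ (fun p : X × E => g p.1 p.2) (W ×ˢ V)) (hW : IsOpen W) (hV : IsOpen V)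
    {z : E} (hz : z ∈ V) (w : E) : DifferentiableOn ℂ (fun x => fderiv ℂ (g x) z w) W := by
  have hD : DifferentiableOn ℂ (fderiv ℂ (fun p : X × E => g p.1 p.2)) (W ×ˢ V) :=
    HolomorphicBanach.differentiableOn_fderiv hG (hW.prod hV)
  have h1 : DifferentiableOn ℂ (fun x => fderiv ℂ (fun p : X × E => g p.1 p.2) (x, z) (0, w)) W :=
    (hD.comp (differentiableOn_id.prodMk (differentiableOn_const z)) fun _ hx => mk_mem_prod hx hz).clm_apply
      (differentiableOn_const _)
  exact h1.congr fun x hx => fderiv_curry_right_apply (hG.differentiableAt ((hW.prod hV).mem_nhds (mk_mem_prod hx hz))) w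

/-- **THE LINEAR TERM IS HOLOMORPHIC IN THE PARAMETER**: `x ↦ lin₁C (g x) w` on `W`. [cite: Chae1985, Thm 14.13; Balaban1987RG1, (2.8) p.266] (elementary complex analysis for Lemma 2's expansion) -/
theorem differentiableOn_param_lin₁C (hG : DifferentiableOn ℂ (fun p : X × E => g p.1 p.2) (W ×ˢ V)) (hW : IsOpen W) (hV : IsOpen V)
    (h0 : (0 : E) ∈ V) (w : E) : DifferentiableOn ℂ (fun x => lin₁C (g x) w) W :=
  (differentiableOn_param_fderiv_apply hG hW hV h0 w).congr fun _ hx =>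
    lin₁C_eq_fderiv ((differentiableOn_of_joint hG hx).differentiableAt (hV.mem_nhds h0)) w

/-- **★ THE QUADRATIC TERM IS HOLOMORPHIC IN THE PARAMETER**: `x ↦ quad₂C (g x) w` on `W` — the second differential of the joint map is holomorphic
(`HolomorphicBanach.differentiableOn_fderiv` applied to `p ↦ DG(p)(0, w)`), and `quad₂C (g x) w = ½·∂_{(0,w)}∂_{(0,w)}G(x, 0)`.
[cite: Chae1985, Thm 14.13; Balaban1987RG1, (2.7)-(2.8) p.266] (elementary complex analysis for Lemma 2's expansion) -/
theorem differentiableOn_param_quad₂C (hG : DifferentiableOn ℂ (fun p : X × E => g p.1 p.2) (W ×ˢ V)) (hW : IsOpen W) (hV : IsOpen V)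
    (h0 : (0 : E) ∈ V) (w : E) : DifferentiableOn ℂ (fun x => quad₂C (g x) w) W := by
  have hWV : IsOpen (W ×ˢ V) := hW.prod hV
  have hD : DifferentiableOn ℂ (fderiv ℂ (fun p : X × E => g p.1 p.2)) (W ×ˢ V) :=
    HolomorphicBanach.differentiableOn_fderiv hG hWV
  -- the first directional derivative of the joint map in the direction `(0, w)`, as a two-variable map
  have hH : DifferentiableOn ℂ (fun p : X × E => (fun x z => fderiv ℂ (fun q : X × E => g q.1 q.2) (x, z) (0, w)) p.1 p.2) (W ×ˢ V) :=
    hD.clm_apply (differentiableOn_const _)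
  have key : ∀ x ∈ W, quad₂C (g x) w =
      (2 : ℂ)⁻¹ • fderiv ℂ (fun z => fderiv ℂ (fun q : X × E => g q.1 q.2) (x, z) (0, w)) 0 w := by
    intro x hx
    have hgx : DifferentiableOn ℂ (g x) V := differentiableOn_of_joint hG hx
    have hev : (fun z => fderiv ℂ (g x) z w) =ᶠ[𝓝 (0 : E)] fun z => fderiv ℂ (fun q : X × E => g q.1 q.2) (x, z) (0, w) := by
      filter_upwards [hV.mem_nhds h0] with z hz
      exact fderiv_curry_right_apply (hG.differentiableAt (hWV.mem_nhds (mk_mem_prod hx hz))) w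
    rw [quad₂C_eq_fderiv_fderiv hgx hV h0, HolomorphicBanach.fderiv_fderiv_apply hgx hV h0 w w, hev.fderiv_eq]
  exact ((differentiableOn_param_fderiv_apply hH hW hV h0 w).const_smul _).congr key

/-- **★ THE THIRD-ORDER REMAINDER AT A FIXED FIELD IS HOLOMORPHIC IN THE PARAMETER**: `x ↦ rem₃C (g x) z` on `W`, for `z ∈ V` — the record's `h𝒲d`
shape (the Wilson remainder «an analytic function of (U, J)», [II] p.10 l.30). [cite: Chae1985, Thm 14.13; Balaban1988RG2Cluster, p.10 ll.30-31; Balaban1987RG1, (2.8) p.266] (elementary complex analysis for Lemma 2's expansion) -/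
theorem differentiableOn_param_rem₃C (hG : DifferentiableOn ℂ (fun p : X × E => g p.1 p.2) (W ×ˢ V)) (hW : IsOpen W) (hV : IsOpen V)
    (h0 : (0 : E) ∈ V) {z : E} (hz : z ∈ V) : DifferentiableOn ℂ (fun x => rem₃C (g x) z) W := by
  show DifferentiableOn ℂ (fun x => g x z - g x 0 - lin₁C (g x) z - quad₂C (g x) z) W
  exact (((differentiableOn_param_apply hG hz).sub (differentiableOn_param_apply hG h0)).sub
    (differentiableOn_param_lin₁C hG hW hV h0 z)).sub (differentiableOn_param_quad₂C hG hW hV h0 z)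

/-- The 2-jet at a fixed field is holomorphic in the parameter. [cite: Chae1985, Thm 14.13; Balaban1987RG1, (2.8) p.266 (bookkeeping)] -/
theorem differentiableOn_param_jet₂C (hG : DifferentiableOn ℂ (fun p : X × E => g p.1 p.2) (W ×ˢ V)) (hW : IsOpen W) (hV : IsOpen V)
    (h0 : (0 : E) ∈ V) (z : E) : DifferentiableOn ℂ (fun x => jet₂C (g x) z) W := by
  show DifferentiableOn ℂ (fun x => g x 0 + lin₁C (g x) z + quad₂C (g x) z) W
  exact ((differentiableOn_param_apply hG h0).add (differentiableOn_param_lin₁C hG hW hV h0 z)).add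
    (differentiableOn_param_quad₂C hG hW hV h0 z)

end Param

end Jet3

/-! ## §3  The localized action read in the complexified unscaled field, its Wilson remainder, the laws and the letter -/

namespace TermDatum214

open TreeLengthTorus Sect2
open Jet3

variable {c : B13.Consts} {P : Params} {𝔸 : Type*} {M k L : ℕ} [NeZero L] (𝔇 : TermDatum214 c P 𝔸 M k L)

/-- **Data type: THE Y-LOCALIZED TERM OF THE EFFECTIVE ACTION READ IN THE COMPLEXIFIED UNSCALED ROW-BOND FIELD, PER CONFIGURATION** — `𝒜ᶜ_{Z,t}(ξ; Y, z)`: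
[I] (2.6) p.266 (the action of the configuration moved by the fluctuation field, expanded in `H₁B′`) localized as [II] (1.37)–(1.38) p.10 (the term of
`V(H₁B′) = Σ_□ V_□(H₁B′)` with localization domain `Y ⊃ □`, by (1.10)), «an analytic function of (U, J) …, and of B′ in the domain {B′ : e^{16κ₁}|B′| ≤ a₁ on Y}»;
the configurations moved by the complex field as in [I] (3.10).  A BARE FUNCTION TYPE per `Z ∈ 𝐃_{k+1}` and term label (hypothesis-schema: NOTHING of
Bałaban's action is constructed; the producer owes the inhabitant with the laws below).
[cite: Balaban1987RG1, (2.6)-(2.8) p.266 and (3.10) p.272; Balaban1988RG2Cluster, (1.37)-(1.38) p.10] -/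
abbrev LocActionC (Z : (domSys P M (k + 1)).Dom) (t : TermLabel P M k L) : Type _ :=
  CPair P 𝔸 → TDom P.d (L * domCount P M (k + 1)) → ((𝔇.𝒦 Z t).Λ → ℂ) → ℂ

/-- **LETTER: THE SUP BOUND OF THE WILSON REMAINDER FROM THE SUP BOUND OF THE ACTION** — `M𝒲(Y) := 8·M𝒜(Y)` (`Jet3.norm_rem₃C_le_const`: `2M𝒜` and `4M𝒜`
are the sup letters of the constant- and affine-peeled action on the ball). [cite: Balaban1988RG2Cluster, (1.39) p.10; Balaban1987RG1, (2.8) p.266] (elementary complex analysis for Lemma 2's expansion) -/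
def wilsonSupBound (M𝒜 : TDom P.d (L * domCount P M (k + 1)) → ℝ) (Y : TDom P.d (L * domCount P M (k + 1))) : ℝ :=
  8 * M𝒜 Y

/-- `wilsonSupBound M𝒜 Y = 8 * M𝒜 Y` (`rfl`). [cite: Balaban1988RG2Cluster, (1.39) p.10 (bookkeeping)] -/
theorem wilsonSupBound_eq (M𝒜 : TDom P.d (L * domCount P M (k + 1)) → ℝ) (Y : TDom P.d (L * domCount P M (k + 1))) :
    wilsonSupBound M𝒜 Y = 8 * M𝒜 Y := rfl

/-- **Sign of the letter** (the record's `hM𝒲` shape): `0 ≤ M𝒜 Y → 0 ≤ wilsonSupBound M𝒜 Y`. [cite: Balaban1988RG2Cluster, (1.39) p.10 (bookkeeping)] -/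
theorem wilsonSupBound_nonneg {M𝒜 : TDom P.d (L * domCount P M (k + 1)) → ℝ} {Y : TDom P.d (L * domCount P M (k + 1))} (h : 0 ≤ M𝒜 Y) :
    0 ≤ wilsonSupBound M𝒜 Y :=
  mul_nonneg (by norm_num) h

namespace LocActionC

variable {𝔇}
variable {Z : (domSys P M (k + 1)).Dom} {t : TermLabel P M k L} (𝒜 : 𝔇.LocActionC Z t)

/-- **THE WILSON REMAINDER OF THE READ ACTION** — `𝒲ᶜ_{Z,t}(ξ; Y, ·) := rem₃C (𝒜 ξ Y)` = the action minus its 2-jet along the complexified field ((2.8)'s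
`V(H₁B′)` localized in `Y`, (1.38): «terms of at least third order»). [cite: Balaban1987RG1, (2.8) p.266; Balaban1988RG2Cluster, (1.38)-(1.39) p.10] -/
def wilsonC : CPair P 𝔸 → TDom P.d (L * domCount P M (k + 1)) → ((𝔇.𝒦 Z t).Λ → ℂ) → ℂ :=
  fun ξ Y => rem₃C (𝒜 ξ Y)

/-- **THE 2-JET OF THE READ ACTION** along the complexified field — (2.8)'s displayed part `A(U_{k+1}) + ⟨H₁B′, J⟩ + ½⟨H₁B′, Δ₁H₁B′⟩`, localized in `Y`.
[cite: Balaban1987RG1, (2.7)-(2.8) p.266] -/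
def actionJetC : CPair P 𝔸 → TDom P.d (L * domCount P M (k + 1)) → ((𝔇.𝒦 Z t).Λ → ℂ) → ℂ :=
  fun ξ Y => jet₂C (𝒜 ξ Y)

/-- `wilsonC` pointwise (`rfl`). [cite: Balaban1987RG1, (2.8) p.266 (bookkeeping)] -/
@[simp] theorem wilsonC_apply (ξ : CPair P 𝔸) (Y : TDom P.d (L * domCount P M (k + 1))) (z : (𝔇.𝒦 Z t).Λ → ℂ) :
    𝒜.wilsonC ξ Y z = rem₃C (𝒜 ξ Y) z := rfl

/-- `wilsonC 𝒜 ξ Y = rem₃C (𝒜 ξ Y)` as maps (`rfl`). [cite: Balaban1987RG1, (2.8) p.266 (bookkeeping)] -/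
theorem wilsonC_eq (ξ : CPair P 𝔸) (Y : TDom P.d (L * domCount P M (k + 1))) : 𝒜.wilsonC ξ Y = rem₃C (𝒜 ξ Y) := rfl

/-- `actionJetC` pointwise (`rfl`). [cite: Balaban1987RG1, (2.8) p.266 (bookkeeping)] -/
@[simp] theorem actionJetC_apply (ξ : CPair P 𝔸) (Y : TDom P.d (L * domCount P M (k + 1))) (z : (𝔇.𝒦 Z t).Λ → ℂ) :
    𝒜.actionJetC ξ Y z = jet₂C (𝒜 ξ Y) z := rfl

/-- **(2.8) AS AN IDENTITY AT THE DATUM**: `𝒜ᶜ(ξ; Y, z) = jet₂ + 𝒲ᶜ(ξ; Y, z)`. [cite: Balaban1987RG1, (2.8) p.266] -/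
theorem actionJetC_add_wilsonC (ξ : CPair P 𝔸) (Y : TDom P.d (L * domCount P M (k + 1))) (z : (𝔇.𝒦 Z t).Λ → ℂ) :
    𝒜.actionJetC ξ Y z + 𝒜.wilsonC ξ Y z = 𝒜 ξ Y z :=
  jet₂C_add_rem₃C (𝒜 ξ Y) z

/-- The ask's form: `𝒲ᶜ(ξ; Y, z) = 𝒜ᶜ(ξ; Y, z) − jet₂(𝒜ᶜ(ξ; Y, ·))(z)`. [cite: Balaban1987RG1, (2.8) p.266] -/
theorem wilsonC_eq_sub (ξ : CPair P 𝔸) (Y : TDom P.d (L * domCount P M (k + 1))) (z : (𝔇.𝒦 Z t).Λ → ℂ) :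
    𝒜.wilsonC ξ Y z = 𝒜 ξ Y z - 𝒜.actionJetC ξ Y z :=
  rem₃C_eq (𝒜 ξ Y) z

/-- The Wilson remainder vanishes at the zero field. [cite: Balaban1987RG1, (2.8) p.266 (bookkeeping)] -/
@[simp] theorem wilsonC_zero_field (ξ : CPair P 𝔸) (Y : TDom P.d (L * domCount P M (k + 1))) : 𝒜.wilsonC ξ Y 0 = 0 :=
  rem₃C_zero (𝒜 ξ Y)

/-! ### §3.1  The laws (displayed `Prop`s on the read action; nothing asserted) -/

/-- **LAW: JOINT ANALYTICITY IN (CONFIGURATION, COMPLEX FIELD)** on the window `W` times the field set `𝔅c`, per localization domain ([II] p.10 ll.30–31: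
«an analytic function of (U, J) in the space …, and of B′ in the domain {B′ : e^{16κ₁}|B′| ≤ a₁ on Y}»; [I] (3.10): the field enters through `exp(iξA)U_{k+1}`).
The source of BOTH the field-holomorphy of the Wilson remainder (`hWd`) and its configuration-holomorphy at a fixed field (`h𝒲d`).
[cite: Balaban1988RG2Cluster, p.10 ll.30-31 and (1.34) p.9; Balaban1987RG1, (3.10) p.272 and §1 p.263] -/
def JointHoloOn [NormedRing 𝔸] [NormedAlgebra ℂ 𝔸] (W : Set (CPair P 𝔸)) (𝔅c : Set ((𝔇.𝒦 Z t).Λ → ℂ)) : Prop :=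
  ∀ Y : TDom P.d (L * domCount P M (k + 1)), DifferentiableOn ℂ (fun p : CPair P 𝔸 × ((𝔇.𝒦 Z t).Λ → ℂ) => 𝒜 p.1 Y p.2) (W ×ˢ 𝔅c)

/-- **LAW: ANALYTICITY IN THE COMPLEX FIELD on `𝔅c`**, at every `ξ ∈ W` and every domain (Lemma 2: «defined and analytic on the space (1.34)»).
[cite: Balaban1988RG2Cluster, p.10 ll.30-31, (1.34) p.9 and Lemma 2 (1.41) p.11] -/
def FieldHoloOn (W : Set (CPair P 𝔸)) (𝔅c : Set ((𝔇.𝒦 Z t).Λ → ℂ)) : Prop :=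
  ∀ ξ ∈ W, ∀ Y : TDom P.d (L * domCount P M (k + 1)), DifferentiableOn ℂ (𝒜 ξ Y) 𝔅c

/-- **LAW: ANALYTICITY IN THE CONFIGURATION on `W`**, at every complex field of `𝔅c` ([I] (2.9)–(2.11): an analytic function of the configuration).
[cite: Balaban1987RG1, §1 p.263 and (3.10) p.272; Balaban1988RG2Cluster, p.10 l.30] -/
def CfgHoloOn [NormedRing 𝔸] [NormedAlgebra ℂ 𝔸] (W : Set (CPair P 𝔸)) (𝔅c : Set ((𝔇.𝒦 Z t).Λ → ℂ)) : Prop :=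
  ∀ Y : TDom P.d (L * domCount P M (k + 1)), ∀ z ∈ 𝔅c, DifferentiableOn ℂ (fun ξ : CPair P 𝔸 => 𝒜 ξ Y z) W

/-- **LAW: THE SUP LETTER OF THE ACTION ON THE BALL, UNIFORM ON THE WINDOW** — `|𝒜ᶜ(ξ; Y, z)| ≤ M𝒜(Y)` for `‖z‖ < R_A`, `ξ ∈ W` (the sup of the analytic
function on the polydisc `{e^{16κ₁}|B′| ≤ a₁ on Y}` behind the cubic bound (1.39); the domain dependence of `M𝒜(Y)` — the decay in `|Y∖□|` — is the
producer's). [cite: Balaban1988RG2Cluster, (1.39) p.10 and (1.36) p.9; Balaban1987RG1, p.266 ll.1-3] -/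
def SupBoundOn (W : Set (CPair P 𝔸)) (RA : ℝ) (M𝒜 : TDom P.d (L * domCount P M (k + 1)) → ℝ) : Prop :=
  ∀ ξ ∈ W, ∀ Y : TDom P.d (L * domCount P M (k + 1)), ∀ z ∈ ball (0 : (𝔇.𝒦 Z t).Λ → ℂ) RA, ‖𝒜 ξ Y z‖ ≤ M𝒜 Y

/-- **LAW: Y-LOCALITY through the bond supports `S Y`** on the term's family `𝐃 = t.1`, at every `ξ ∈ W` («localized in the interior of Y, with respect to
U, J, B′ or B», p.10 l.29; (1.34) p.9). [cite: Balaban1988RG2Cluster, p.10 l.29 and (1.34) p.9] -/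
def LocalInC (W : Set (CPair P 𝔸)) (S : TDom P.d (L * domCount P M (k + 1)) → Finset (𝔇.𝒦 Z t).Λ) : Prop :=
  ∀ ξ ∈ W, ∀ Y ∈ t.1, ∀ z z' : (𝔇.𝒦 Z t).Λ → ℂ, (∀ b ∈ S Y, z b = z' b) → 𝒜 ξ Y z = 𝒜 ξ Y z'

/-- **LAW: MEASURABILITY OF THE REAL SLICE of the action in the unscaled field**, at every `ξ ∈ W` (the integrand of the fluctuation integral (2.1) ∕
(1.2.13) is a measurable function of `B′`). [cite: Balaban1987RG1, (2.1) p.265 and (2.10) p.267; Balaban1988RG2Cluster, Lemma 2 (1.41) p.11] -/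
def RealSliceMeasurable (W : Set (CPair P 𝔸)) : Prop :=
  ∀ ξ ∈ W, ∀ Y : TDom P.d (L * domCount P M (k + 1)), Measurable fun A : (𝔇.𝒦 Z t).Λ → ℝ => 𝒜 ξ Y (ofRealVec A)

variable {𝒜}

/-- Bridge: joint analyticity gives analyticity in the field at every `ξ ∈ W`. [cite: Balaban1988RG2Cluster, p.10 ll.30-31 (bookkeeping)] -/
theorem JointHoloOn.fieldHoloOn [NormedRing 𝔸] [NormedAlgebra ℂ 𝔸] {W : Set (CPair P 𝔸)} {𝔅c : Set ((𝔇.𝒦 Z t).Λ → ℂ)}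
    (h : 𝒜.JointHoloOn W 𝔅c) : 𝒜.FieldHoloOn W 𝔅c :=
  fun _ hξ Y => differentiableOn_of_joint (g := fun ξ z => 𝒜 ξ Y z) (h Y) hξ

/-- Bridge: joint analyticity gives analyticity in the configuration at every field of `𝔅c`. [cite: Balaban1988RG2Cluster, p.10 l.30 (bookkeeping)] -/
theorem JointHoloOn.cfgHoloOn [NormedRing 𝔸] [NormedAlgebra ℂ 𝔸] {W : Set (CPair P 𝔸)} {𝔅c : Set ((𝔇.𝒦 Z t).Λ → ℂ)}
    (h : 𝒜.JointHoloOn W 𝔅c) : 𝒜.CfgHoloOn W 𝔅c :=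
  fun Y _ hz => differentiableOn_param_apply (g := fun ξ z => 𝒜 ξ Y z) (h Y) hz

/-- Bridge: the laws restrict to smaller windows ∕ field sets. [cite: Balaban1988RG2Cluster, (1.34) p.9 (bookkeeping)] -/
theorem JointHoloOn.mono [NormedRing 𝔸] [NormedAlgebra ℂ 𝔸] {W W' : Set (CPair P 𝔸)} {𝔅c 𝔅c' : Set ((𝔇.𝒦 Z t).Λ → ℂ)}
    (h : 𝒜.JointHoloOn W 𝔅c) (hW : W' ⊆ W) (h𝔅 : 𝔅c' ⊆ 𝔅c) : 𝒜.JointHoloOn W' 𝔅c' :=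
  fun Y => (h Y).mono (prod_mono hW h𝔅)

/-- Bridge: field analyticity restricts. [cite: Balaban1988RG2Cluster, (1.34) p.9 (bookkeeping)] -/
theorem FieldHoloOn.mono {W W' : Set (CPair P 𝔸)} {𝔅c 𝔅c' : Set ((𝔇.𝒦 Z t).Λ → ℂ)} (h : 𝒜.FieldHoloOn W 𝔅c) (hW : W' ⊆ W)
    (h𝔅 : 𝔅c' ⊆ 𝔅c) : 𝒜.FieldHoloOn W' 𝔅c' :=
  fun ξ hξ Y => (h ξ (hW hξ) Y).mono h𝔅

/-- Bridge: the sup letter restricts to smaller windows and radii and weakens to larger letters. [cite: Balaban1988RG2Cluster, (1.39) p.10 (bookkeeping)] -/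
theorem SupBoundOn.mono {W W' : Set (CPair P 𝔸)} {RA RA' : ℝ} {M𝒜 M𝒜' : TDom P.d (L * domCount P M (k + 1)) → ℝ} (h : 𝒜.SupBoundOn W RA M𝒜)
    (hW : W' ⊆ W) (hR : RA' ≤ RA) (hM : ∀ Y, M𝒜 Y ≤ M𝒜' Y) : 𝒜.SupBoundOn W' RA' M𝒜' :=
  fun ξ hξ Y z hz => (h ξ (hW hξ) Y z (ball_subset_ball hR hz)).trans (hM Y)

/-- Bridge: on a nonempty window the sup letter is nonnegative (at the zero field). [cite: Balaban1988RG2Cluster, (1.39) p.10 (bookkeeping)] -/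
theorem SupBoundOn.nonneg {W : Set (CPair P 𝔸)} {RA : ℝ} {M𝒜 : TDom P.d (L * domCount P M (k + 1)) → ℝ} (h : 𝒜.SupBoundOn W RA M𝒜)
    (hRA : 0 < RA) {ξ : CPair P 𝔸} (hξ : ξ ∈ W) (Y : TDom P.d (L * domCount P M (k + 1))) : 0 ≤ M𝒜 Y :=
  nonneg_of_bound hRA (h ξ hξ Y)

/-- Bridge: locality restricts to smaller windows and larger supports. [cite: Balaban1988RG2Cluster, (1.34) p.9 (bookkeeping)] -/
theorem LocalInC.mono {W W' : Set (CPair P 𝔸)} {S S' : TDom P.d (L * domCount P M (k + 1)) → Finset (𝔇.𝒦 Z t).Λ} (h : 𝒜.LocalInC W S)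
    (hW : W' ⊆ W) (hS : ∀ Y ∈ t.1, S Y ⊆ S' Y) : 𝒜.LocalInC W' S' :=
  fun ξ hξ Y hY z z' hz => h ξ (hW hξ) Y hY z z' fun b hb => hz b (hS Y hY hb)

/-- Bridge: field analyticity on a field set containing every real field gives measurability of the real slice (continuity route).
[cite: Balaban1988RG2Cluster, Lemma 2 (1.41) p.11 (bookkeeping)] -/
theorem FieldHoloOn.realSliceMeasurable {W : Set (CPair P 𝔸)} {𝔅c : Set ((𝔇.𝒦 Z t).Λ → ℂ)} (h : 𝒜.FieldHoloOn W 𝔅c)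
    (h𝔅 : ∀ A : (𝔇.𝒦 Z t).Λ → ℝ, ofRealVec A ∈ 𝔅c) : 𝒜.RealSliceMeasurable W :=
  fun ξ hξ Y => ((h ξ hξ Y).continuousOn.comp_continuous continuous_ofRealVec h𝔅).measurable

/-! ### §3.2  Honesty instance: the zero action satisfies every law, with zero Wilson remainder -/

/-- Honesty: the zero action's Wilson remainder is zero. [cite: Balaban1987RG1, (2.8) p.266 (degenerate instance)] -/
@[simp] theorem wilsonC_zero (ξ : CPair P 𝔸) (Y : TDom P.d (L * domCount P M (k + 1))) (z : (𝔇.𝒦 Z t).Λ → ℂ) :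
    (0 : 𝔇.LocActionC Z t).wilsonC ξ Y z = 0 := by
  rw [wilsonC_apply]
  have h : (0 : 𝔇.LocActionC Z t) ξ Y = 0 := rfl
  rw [h, rem₃C_zero_fun]
  rfl

/-- Honesty: the zero action is jointly analytic. [cite: Balaban1988RG2Cluster, p.10 ll.30-31 (degenerate instance)] -/
theorem zero_jointHoloOn [NormedRing 𝔸] [NormedAlgebra ℂ 𝔸] (W : Set (CPair P 𝔸)) (𝔅c : Set ((𝔇.𝒦 Z t).Λ → ℂ)) :
    (0 : 𝔇.LocActionC Z t).JointHoloOn W 𝔅c :=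
  fun _ => differentiableOn_const (0 : ℂ)

/-- Honesty: the zero action is analytic in the field. [cite: Balaban1988RG2Cluster, (1.34) p.9 (degenerate instance)] -/
theorem zero_fieldHoloOn (W : Set (CPair P 𝔸)) (𝔅c : Set ((𝔇.𝒦 Z t).Λ → ℂ)) : (0 : 𝔇.LocActionC Z t).FieldHoloOn W 𝔅c :=
  fun _ _ _ => differentiableOn_const (0 : ℂ)

/-- Honesty: the zero action is analytic in the configuration. [cite: Balaban1987RG1, (3.10) p.272 (degenerate instance)] -/
theorem zero_cfgHoloOn [NormedRing 𝔸] [NormedAlgebra ℂ 𝔸] (W : Set (CPair P 𝔸)) (𝔅c : Set ((𝔇.𝒦 Z t).Λ → ℂ)) :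
    (0 : 𝔇.LocActionC Z t).CfgHoloOn W 𝔅c :=
  fun _ _ _ => differentiableOn_const (0 : ℂ)

/-- Honesty: the zero action has sup letter `0`. [cite: Balaban1988RG2Cluster, (1.39) p.10 (degenerate instance)] -/
theorem zero_supBoundOn (W : Set (CPair P 𝔸)) (RA : ℝ) : (0 : 𝔇.LocActionC Z t).SupBoundOn W RA fun _ => 0 :=
  fun _ _ _ _ _ => by simp

/-- Honesty: the zero action is local through any supports. [cite: Balaban1988RG2Cluster, (1.34) p.9 (degenerate instance)] -/
theorem zero_localInC (W : Set (CPair P 𝔸)) (S : TDom P.d (L * domCount P M (k + 1)) → Finset (𝔇.𝒦 Z t).Λ) :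
    (0 : 𝔇.LocActionC Z t).LocalInC W S :=
  fun _ _ _ _ _ _ _ => rfl

/-- Honesty: the zero action has measurable real slices. [cite: Balaban1987RG1, (2.1) p.265 (degenerate instance)] -/
theorem zero_realSliceMeasurable (W : Set (CPair P 𝔸)) : (0 : 𝔇.LocActionC Z t).RealSliceMeasurable W :=
  fun _ _ _ => measurable_const

/-! ## §4  Slice-level faces: the record's Wilson block shapes at `Wc Z t := wilsonC 𝒜`, `𝒲 Z t ξ Y A := wilsonC 𝒜 ξ Y (A ↪ ℂ)` -/

section Faces

variable {W : Set (CPair P 𝔸)} {𝔅c : Set ((𝔇.𝒦 Z t).Λ → ℂ)} {RA : ℝ} {M𝒜 : TDom P.d (L * domCount P M (k + 1)) → ℝ}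
  {S : TDom P.d (L * domCount P M (k + 1)) → Finset (𝔇.𝒦 Z t).Λ}

/-- **★ Face (`hWB` shape): THE WILSON REMAINDER BEGINS AT ORDER THREE at every `ξ ∈ W` and every domain** — from field analyticity on `𝔅c ⊇ ball 0 R_A` and
the sup letter alone. [cite: Balaban1987RG1, (2.8) p.266; Balaban1988RG2Cluster, (1.38)-(1.39) p.10 and Lemma 2 (1.41) p.11] -/
theorem beginsAt_wilsonC (hRA : 0 < RA) (hhol : 𝒜.FieldHoloOn W 𝔅c) (h𝔅 : ball 0 RA ⊆ 𝔅c) (hM : 𝒜.SupBoundOn W RA M𝒜) :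
    ∀ ξ ∈ W, ∀ Y : TDom P.d (L * domCount P M (k + 1)), BeginsAt (𝒜.wilsonC ξ Y) 3 :=
  fun ξ hξ Y => beginsAt_rem₃C hRA ((hhol ξ hξ Y).mono h𝔅) (hM ξ hξ Y)

/-- **★ Face: THE CUBIC BOUND (1.39) of the Wilson remainder on the ball** — `|𝒲ᶜ(ξ; Y, z)| ≤ 8M𝒜(Y)·(‖z‖∕R_A)³`.
[cite: Balaban1988RG2Cluster, (1.39) p.10; Balaban1987RG1, (2.8) p.266] -/
theorem norm_wilsonC_le_cubic (hRA : 0 < RA) (hhol : 𝒜.FieldHoloOn W 𝔅c) (h𝔅 : ball 0 RA ⊆ 𝔅c) (hM : 𝒜.SupBoundOn W RA M𝒜) :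
    ∀ ξ ∈ W, ∀ Y : TDom P.d (L * domCount P M (k + 1)), ∀ z ∈ ball (0 : (𝔇.𝒦 Z t).Λ → ℂ) RA,
      ‖𝒜.wilsonC ξ Y z‖ ≤ wilsonSupBound M𝒜 Y * (‖z‖ / RA) ^ 3 :=
  fun ξ hξ Y z hz => by
  rw [wilsonSupBound_eq]
  exact norm_rem₃C_le hRA ((hhol ξ hξ Y).mono h𝔅) (hM ξ hξ Y) z hz

/-- **★ Face (`hWM` shape): THE SUP BOUND of the Wilson remainder on the ball with the letter `M𝒲 := wilsonSupBound M𝒜`**, at every `ξ ∈ W`.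
[cite: Balaban1988RG2Cluster, (1.39) p.10 and Lemma 2 (1.41) p.11; Balaban1987RG1, (2.8) p.266] -/
theorem norm_wilsonC_le (hRA : 0 < RA) (hhol : 𝒜.FieldHoloOn W 𝔅c) (h𝔅 : ball 0 RA ⊆ 𝔅c) (hM : 𝒜.SupBoundOn W RA M𝒜) :
    ∀ ξ ∈ W, ∀ Y : TDom P.d (L * domCount P M (k + 1)), ∀ z ∈ ball (0 : (𝔇.𝒦 Z t).Λ → ℂ) RA, ‖𝒜.wilsonC ξ Y z‖ ≤ wilsonSupBound M𝒜 Y :=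
  fun ξ hξ Y z hz => by
  rw [wilsonSupBound_eq]
  exact norm_rem₃C_le_const hRA ((hhol ξ hξ Y).mono h𝔅) (hM ξ hξ Y) z hz

/-- **★ Face: THE WILSON REMAINDER IS ANALYTIC IN THE FIELD on the open field set** (⊇ the record's `hWd`), at every `ξ ∈ W`.
[cite: Balaban1988RG2Cluster, p.10 ll.30-31 and Lemma 2 (1.41) p.11; Balaban1987RG1, (2.8) p.266] -/
theorem differentiableOn_wilsonC_field (hhol : 𝒜.FieldHoloOn W 𝔅c) (h𝔅o : IsOpen 𝔅c) (h0 : (0 : (𝔇.𝒦 Z t).Λ → ℂ) ∈ 𝔅c) :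
    ∀ ξ ∈ W, ∀ Y : TDom P.d (L * domCount P M (k + 1)), DifferentiableOn ℂ (𝒜.wilsonC ξ Y) 𝔅c :=
  fun ξ hξ Y => differentiableOn_rem₃C (hhol ξ hξ Y) h𝔅o h0

/-- **★ Face (`hWd` shape): the Wilson remainder is analytic in the field ON THE BALL `‖z‖ < R_A`**, at every `ξ ∈ W`.
[cite: Balaban1988RG2Cluster, Lemma 2 (1.41) p.11 and (1.34) p.9; Balaban1987RG1, (2.8) p.266] -/
theorem differentiableOn_wilsonC_ball (hRA : 0 < RA) (hhol : 𝒜.FieldHoloOn W 𝔅c) (h𝔅o : IsOpen 𝔅c) (h𝔅 : ball 0 RA ⊆ 𝔅c) :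
    ∀ ξ ∈ W, ∀ Y : TDom P.d (L * domCount P M (k + 1)), DifferentiableOn ℂ (𝒜.wilsonC ξ Y) (ball 0 RA) :=
  fun ξ hξ Y => differentiableOn_rem₃C_of_subset (hhol ξ hξ Y) h𝔅o (h𝔅 (mem_ball_self hRA)) h𝔅

/-- **★ Face: THE WILSON REMAINDER AT A COMPLEX FIELD IS ANALYTIC IN THE CONFIGURATION on the open window**, from JOINT analyticity.
[cite: Balaban1988RG2Cluster, p.10 l.30; Balaban1987RG1, (2.9)-(2.11) pp.266-267 and (3.10) p.272; Chae1985, Thm 14.13] -/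
theorem differentiableOn_wilsonC_config [NormedRing 𝔸] [NormedAlgebra ℂ 𝔸] (hj : 𝒜.JointHoloOn W 𝔅c) (hW : IsOpen W) (h𝔅o : IsOpen 𝔅c)
    (h0 : (0 : (𝔇.𝒦 Z t).Λ → ℂ) ∈ 𝔅c) :
    ∀ Y : TDom P.d (L * domCount P M (k + 1)), ∀ z ∈ 𝔅c, DifferentiableOn ℂ (fun ξ : CPair P 𝔸 => 𝒜.wilsonC ξ Y z) W :=
  fun Y _ hz => differentiableOn_param_rem₃C (g := fun ξ z => 𝒜 ξ Y z) (hj Y) hW h𝔅o h0 hz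

/-- **★ Face (`h𝒲d` shape): THE REAL SLICE OF THE WILSON REMAINDER IS ANALYTIC IN THE CONFIGURATION at EVERY real field**, when the field set contains
every real field (e.g. `𝔅c = univ`, «entire in the field»). [cite: Balaban1987RG1, (2.9)-(2.11) pp.266-267 and (3.10) p.272; Balaban1988RG2Cluster, p.10 l.30; Chae1985, Thm 14.13] -/
theorem differentiableOn_wilsonC_config_realSlice [NormedRing 𝔸] [NormedAlgebra ℂ 𝔸] (hj : 𝒜.JointHoloOn W 𝔅c) (hW : IsOpen W)
    (h𝔅o : IsOpen 𝔅c) (h𝔅 : ∀ A : (𝔇.𝒦 Z t).Λ → ℝ, ofRealVec A ∈ 𝔅c) :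
    ∀ (Y : TDom P.d (L * domCount P M (k + 1))) (A : ((𝔇.𝒦 Z t).Λ → ℝ)),
      DifferentiableOn ℂ (fun ξ : CPair P 𝔸 => 𝒜.wilsonC ξ Y (ofRealVec A)) W :=
  fun Y A => differentiableOn_wilsonC_config hj hW h𝔅o (by simpa [ofRealVec_zero] using h𝔅 0) Y _ (h𝔅 A)

/-- **★ Face (`h𝒲m` shape): THE REAL SLICE OF THE WILSON REMAINDER IS MEASURABLE**, at every `ξ ∈ W`, from the measurability law of the action's real
slice (module 48's pointwise-limit route; no continuity asked). [cite: Balaban1988RG2Cluster, Lemma 2 (1.41) p.11; Balaban1987RG1, (2.1) p.265 and (2.8) p.266] -/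
theorem measurable_wilsonC_realSlice (hRA : 0 < RA) (hhol : 𝒜.FieldHoloOn W 𝔅c) (h𝔅 : ball 0 RA ⊆ 𝔅c) (hM : 𝒜.SupBoundOn W RA M𝒜)
    (hm : 𝒜.RealSliceMeasurable W) :
    ∀ ξ ∈ W, ∀ Y : TDom P.d (L * domCount P M (k + 1)), Measurable fun A : (𝔇.𝒦 Z t).Λ → ℝ => 𝒜.wilsonC ξ Y (ofRealVec A) :=
  fun ξ hξ Y => measurable_rem₃C_realSlice hRA ((hhol ξ hξ Y).mono h𝔅) (hM ξ hξ Y) (hm ξ hξ Y)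

/-- Face (`h𝒲m` shape, continuity route): the real slice of the Wilson remainder is measurable when the field set is open and contains every real field.
[cite: Balaban1988RG2Cluster, Lemma 2 (1.41) p.11 (bookkeeping)] -/
theorem measurable_wilsonC_realSlice_of_holo (hhol : 𝒜.FieldHoloOn W 𝔅c) (h𝔅o : IsOpen 𝔅c) (h𝔅 : ∀ A : (𝔇.𝒦 Z t).Λ → ℝ, ofRealVec A ∈ 𝔅c) :
    ∀ ξ ∈ W, ∀ Y : TDom P.d (L * domCount P M (k + 1)), Measurable fun A : (𝔇.𝒦 Z t).Λ → ℝ => 𝒜.wilsonC ξ Y (ofRealVec A) :=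
  fun ξ hξ Y => measurable_rem₃C_realSlice_of_holo (hhol ξ hξ Y) h𝔅o h𝔅

/-- **★ Face: THE WILSON REMAINDER IS Y-LOCAL through the supports `S Y`** on `𝐃 = t.1`, at every `ξ ∈ W` and all complex fields.
[cite: Balaban1988RG2Cluster, p.10 l.29 and (1.34) p.9] -/
theorem wilsonC_local (hloc : 𝒜.LocalInC W S) :
    ∀ ξ ∈ W, ∀ Y ∈ t.1, ∀ z z' : (𝔇.𝒦 Z t).Λ → ℂ, (∀ b ∈ S Y, z b = z' b) → 𝒜.wilsonC ξ Y z = 𝒜.wilsonC ξ Y z' :=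
  fun ξ hξ Y hY => rem₃C_local (S Y) (hloc ξ hξ Y hY)

/-- **★ Face (`hlocY𝒲` shape): THE REAL SLICE OF THE WILSON REMAINDER IS Y-LOCAL through the supports `S Y`**, at every `ξ ∈ W`.
[cite: Balaban1988RG2Cluster, p.10 l.29 and (1.34) p.9] -/
theorem wilsonC_local_realSlice (hloc : 𝒜.LocalInC W S) :
    ∀ ξ ∈ W, ∀ Y ∈ t.1, ∀ A A' : ((𝔇.𝒦 Z t).Λ → ℝ), (∀ b ∈ S Y, A b = A' b) → 𝒜.wilsonC ξ Y (ofRealVec A) = 𝒜.wilsonC ξ Y (ofRealVec A') :=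
  fun ξ hξ Y hY => rem₃C_local_realSlice (S Y) (hloc ξ hξ Y hY)

/-- Face: module 48's cubic part of the Wilson remainder is its order-3 part read off the action (bookkeeping identity `cubicPart (wilsonC 𝒜 ξ Y) A =
homPart (rem₃C (𝒜 ξ Y)) 3 (A ↪ ℂ)`, `rfl`) — so J17-M's `𝒲₃ := cubicPart ∘ Wc` is determined by the action. [cite: Balaban1988RG2Cluster, Lemma 2 (1.42) p.11 (bookkeeping)] -/
theorem cubicPart_wilsonC (ξ : CPair P 𝔸) (Y : TDom P.d (L * domCount P M (k + 1))) (A : (𝔇.𝒦 Z t).Λ → ℝ) :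
    cubicPart (𝒜.wilsonC ξ Y) A = homPart (rem₃C (𝒜 ξ Y)) 3 (ofRealVec A) := rfl

end Faces

end LocActionC

/-! ## §5  The datum-level reading: a `ComplexWilson` read off a family of actions, and its real slice -/

variable {𝔇}

/-- **THE COMPLEX WILSON REMAINDER READ OFF A FAMILY OF LOCALIZED ACTIONS** (one per term slice): storey 12b's `ComplexWilson` given slice by slice by
`LocActionC.wilsonC` — the record's `Wc` for a read datum. [cite: Balaban1987RG1, (2.8) p.266; Balaban1988RG2Cluster, (1.38) p.10 and Lemma 2 (1.41)-(1.42) p.11] -/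
def readWilsonC (𝒜c : (Z : (domSys P M (k + 1)).Dom) → (t : TermLabel P M k L) → 𝔇.LocActionC Z t) : 𝔇.ComplexWilson :=
  fun Z t ξ Y z => (𝒜c Z t).wilsonC ξ Y z

/-- Face: the read Wilson remainder at a slice (`rfl`). [cite: Balaban1988RG2Cluster, Lemma 2 (1.41) p.11 (bookkeeping)] -/
@[simp] theorem readWilsonC_apply (𝒜c : (Z : (domSys P M (k + 1)).Dom) → (t : TermLabel P M k L) → 𝔇.LocActionC Z t)
    (Z : (domSys P M (k + 1)).Dom) (t : TermLabel P M k L) (ξ : CPair P 𝔸) (Y : TDom P.d (L * domCount P M (k + 1))) (z : (𝔇.𝒦 Z t).Λ → ℂ) :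
    𝔇.readWilsonC 𝒜c Z t ξ Y z = (𝒜c Z t).wilsonC ξ Y z :=
  rfl

/-- Face: the read Wilson remainder at a slice, as a map of the field (`rfl`). [cite: Balaban1988RG2Cluster, Lemma 2 (1.41) p.11 (bookkeeping)] -/
theorem readWilsonC_eq (𝒜c : (Z : (domSys P M (k + 1)).Dom) → (t : TermLabel P M k L) → 𝔇.LocActionC Z t)
    (Z : (domSys P M (k + 1)).Dom) (t : TermLabel P M k L) (ξ : CPair P 𝔸) (Y : TDom P.d (L * domCount P M (k + 1))) :
    𝔇.readWilsonC 𝒜c Z t ξ Y = (𝒜c Z t).wilsonC ξ Y :=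
  rfl

/-- **★ Face (`h𝒲re` shape): THE REAL SLICE OF THE READ WILSON REMAINDER IS THE READ WILSON REMAINDER AT THE COMPLEXIFIED REAL FIELD** (`rfl`) — a producer
defining the law's `𝒲 := realSliceWilson (readWilsonC 𝒜c)` at `Wc := readWilsonC 𝒜c` has the record's `h𝒲re` by `rfl`.
[cite: Balaban1988RG2Cluster, (1.38) p.10 and Lemma 2 (1.41) p.11; Balaban1987RG1, (2.8) p.266] -/
theorem realSliceWilson_readWilsonC_apply (𝒜c : (Z : (domSys P M (k + 1)).Dom) → (t : TermLabel P M k L) → 𝔇.LocActionC Z t)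
    (Z : (domSys P M (k + 1)).Dom) (t : TermLabel P M k L) (ξ : CPair P 𝔸) (Y : TDom P.d (L * domCount P M (k + 1))) (A : (𝔇.𝒦 Z t).Λ → ℝ) :
    𝔇.realSliceWilson (𝔇.readWilsonC 𝒜c) Z t ξ Y A = 𝔇.readWilsonC 𝒜c Z t ξ Y (ofRealVec A) :=
  rfl

/-- Face: the real slice of the read Wilson remainder, through the action (`rfl`). [cite: Balaban1988RG2Cluster, Lemma 2 (1.41) p.11 (bookkeeping)] -/
theorem realSliceWilson_readWilsonC_eq (𝒜c : (Z : (domSys P M (k + 1)).Dom) → (t : TermLabel P M k L) → 𝔇.LocActionC Z t)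
    (Z : (domSys P M (k + 1)).Dom) (t : TermLabel P M k L) (ξ : CPair P 𝔸) (Y : TDom P.d (L * domCount P M (k + 1))) (A : (𝔇.𝒦 Z t).Λ → ℝ) :
    𝔇.realSliceWilson (𝔇.readWilsonC 𝒜c) Z t ξ Y A = rem₃C (𝒜c Z t ξ Y) (ofRealVec A) :=
  rfl

/-! ## §6  The hypothesis schema on an opaque complex Wilson remainder, and the transfer faces (the record's Wilson block VERBATIM) -/

/-- **HYPOTHESIS SCHEMA (located, one slice): on the window `W` and the complex field set `𝔅c` the record's opaque `Wc Z t ξ Y` AGREES WITH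
`wilsonC 𝒜 ξ Y` — the read localized action `𝒜` expanded past its 2-jet** ([I] (2.8) ∕ [II] (1.37)–(1.38): «V … comes from the expansion … of the
Wilson action», p.10 ll.9–11), where print states it. [cite: Balaban1988RG2Cluster, (1.37)-(1.38) p.10 and Lemma 2 (1.41)-(1.42) p.11; Balaban1987RG1, (2.6)-(2.8) p.266] -/
def WilsonOfActionOn (Wc : 𝔇.ComplexWilson) (Z : (domSys P M (k + 1)).Dom) (t : TermLabel P M k L) (𝒜 : 𝔇.LocActionC Z t)
    (W : Set (CPair P 𝔸)) (𝔅c : Set ((𝔇.𝒦 Z t).Λ → ℂ)) : Prop :=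
  ∀ ξ ∈ W, ∀ Y : TDom P.d (L * domCount P M (k + 1)), ∀ z ∈ 𝔅c, Wc Z t ξ Y z = 𝒜.wilsonC ξ Y z

/-- Face: the read Wilson remainder is the remainder of its actions, on any window and field set (`rfl`). [cite: Balaban1988RG2Cluster, Lemma 2 (1.41) p.11 (bookkeeping)] -/
theorem wilsonOfActionOn_readWilsonC (𝒜c : (Z : (domSys P M (k + 1)).Dom) → (t : TermLabel P M k L) → 𝔇.LocActionC Z t)
    (Z : (domSys P M (k + 1)).Dom) (t : TermLabel P M k L) (W : Set (CPair P 𝔸)) (𝔅c : Set ((𝔇.𝒦 Z t).Λ → ℂ)) :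
    𝔇.WilsonOfActionOn (𝔇.readWilsonC 𝒜c) Z t (𝒜c Z t) W 𝔅c :=
  fun _ _ _ _ _ => rfl

namespace WilsonOfActionOn

variable {Wc : 𝔇.ComplexWilson} {Z : (domSys P M (k + 1)).Dom} {t : TermLabel P M k L} {𝒜 : 𝔇.LocActionC Z t}
  {W : Set (CPair P 𝔸)} {𝔅c : Set ((𝔇.𝒦 Z t).Λ → ℂ)} {RA : ℝ} {M𝒜 : TDom P.d (L * domCount P M (k + 1)) → ℝ}
  {S : TDom P.d (L * domCount P M (k + 1)) → Finset (𝔇.𝒦 Z t).Λ}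

/-- Face: the schema restricts to smaller windows ∕ field sets. [cite: Balaban1988RG2Cluster, Lemma 2 (1.41) p.11 (bookkeeping)] -/
theorem mono {W' : Set (CPair P 𝔸)} {𝔅c' : Set ((𝔇.𝒦 Z t).Λ → ℂ)} (h : 𝔇.WilsonOfActionOn Wc Z t 𝒜 W 𝔅c) (hW : W' ⊆ W) (h𝔅 : 𝔅c' ⊆ 𝔅c) :
    𝔇.WilsonOfActionOn Wc Z t 𝒜 W' 𝔅c' :=
  fun ξ hξ Y z hz => h ξ (hW hξ) Y z (h𝔅 hz)

/-- Face: under the schema `Wc Z t ξ Y` and `wilsonC 𝒜 ξ Y` agree on `𝔅c`. [cite: Balaban1988RG2Cluster, Lemma 2 (1.41) p.11 (bookkeeping)] -/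
theorem eqOn (h : 𝔇.WilsonOfActionOn Wc Z t 𝒜 W 𝔅c) {ξ : CPair P 𝔸} (hξ : ξ ∈ W) (Y : TDom P.d (L * domCount P M (k + 1))) :
    EqOn (Wc Z t ξ Y) (𝒜.wilsonC ξ Y) 𝔅c :=
  fun z hz => h ξ hξ Y z hz

/-- **★ Transfer (`h𝒲re` VERBATIM): the real slice of `Wc` — for the read pair this is `rfl`; under the schema on a field set containing every real field it
reads the action's remainder.** [cite: Balaban1988RG2Cluster, (1.38) p.10 and Lemma 2 (1.41) p.11 (bookkeeping)] -/
theorem realSlice_apply (h : 𝔇.WilsonOfActionOn Wc Z t 𝒜 W 𝔅c) (h𝔅 : ∀ A : (𝔇.𝒦 Z t).Λ → ℝ, ofRealVec A ∈ 𝔅c) :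
    ∀ ξ ∈ W, ∀ (Y : TDom P.d (L * domCount P M (k + 1))) (A : ((𝔇.𝒦 Z t).Λ → ℝ)),
      𝔇.realSliceWilson Wc Z t ξ Y A = 𝒜.wilsonC ξ Y (ofRealVec A) :=
  fun ξ hξ Y A => h ξ hξ Y (ofRealVec A) (h𝔅 A)

/-- **Transfer (`h𝒲re`, function form — the name announced in the INTENT): under the schema on a field set containing every real field, the real slice
of `Wc` at `ξ ∈ W`, `Y` equals `A ↦ wilsonC 𝒜 ξ Y (ofRealVec A)`.** [cite: Balaban1988RG2Cluster, (1.38) p.10 and Lemma 2 (1.41) p.11 (bookkeeping)] -/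
theorem realSlice_eq (h : 𝔇.WilsonOfActionOn Wc Z t 𝒜 W 𝔅c) (h𝔅 : ∀ A : (𝔇.𝒦 Z t).Λ → ℝ, ofRealVec A ∈ 𝔅c) {ξ : CPair P 𝔸} (hξ : ξ ∈ W)
    (Y : TDom P.d (L * domCount P M (k + 1))) :
    𝔇.realSliceWilson Wc Z t ξ Y = fun A => 𝒜.wilsonC ξ Y (ofRealVec A) :=
  funext fun A => h.realSlice_apply h𝔅 ξ hξ Y A

/-- **★ Transfer (`hWB` VERBATIM): THIRD-ORDER ONSET of an opaque `Wc` that is the remainder of an action on an open field set about `0` containing the ball.**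
[cite: Balaban1987RG1, (2.8) p.266; Balaban1988RG2Cluster, (1.38)-(1.39) p.10 and Lemma 2 (1.41) p.11] -/
theorem beginsAt (h : 𝔇.WilsonOfActionOn Wc Z t 𝒜 W 𝔅c) (h𝔅o : IsOpen 𝔅c) (hRA : 0 < RA) (h𝔅 : ball 0 RA ⊆ 𝔅c)
    (hhol : 𝒜.FieldHoloOn W 𝔅c) (hM : 𝒜.SupBoundOn W RA M𝒜) :
    ∀ ξ ∈ W, ∀ Y : TDom P.d (L * domCount P M (k + 1)), BeginsAt (Wc Z t ξ Y) 3 :=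
  fun ξ hξ Y => beginsAt_of_eqOn h𝔅o (h𝔅 (mem_ball_self hRA)) (h.eqOn hξ Y) (LocActionC.beginsAt_wilsonC hRA hhol h𝔅 hM ξ hξ Y)

/-- **★ Transfer (`hWM` VERBATIM, `M𝒲 := wilsonSupBound M𝒜`): THE SUP BOUND of an opaque `Wc` read as the remainder of an action, on the ball.**
[cite: Balaban1988RG2Cluster, (1.39) p.10 and Lemma 2 (1.41) p.11; Balaban1987RG1, (2.8) p.266] -/
theorem norm_le (h : 𝔇.WilsonOfActionOn Wc Z t 𝒜 W 𝔅c) (hRA : 0 < RA) (h𝔅 : ball 0 RA ⊆ 𝔅c) (hhol : 𝒜.FieldHoloOn W 𝔅c)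
    (hM : 𝒜.SupBoundOn W RA M𝒜) :
    ∀ ξ ∈ W, ∀ Y : TDom P.d (L * domCount P M (k + 1)), ∀ z ∈ ball (0 : ((𝔇.𝒦 Z t).Λ → ℂ)) RA, ‖Wc Z t ξ Y z‖ ≤ wilsonSupBound M𝒜 Y :=
  fun ξ hξ Y z hz => by
  rw [h ξ hξ Y z (h𝔅 hz)]
  exact LocActionC.norm_wilsonC_le hRA hhol h𝔅 hM ξ hξ Y z hz

/-- Transfer: the cubic bound (1.39) of an opaque `Wc` read as the remainder of an action. [cite: Balaban1988RG2Cluster, (1.39) p.10] -/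
theorem norm_le_cubic (h : 𝔇.WilsonOfActionOn Wc Z t 𝒜 W 𝔅c) (hRA : 0 < RA) (h𝔅 : ball 0 RA ⊆ 𝔅c) (hhol : 𝒜.FieldHoloOn W 𝔅c)
    (hM : 𝒜.SupBoundOn W RA M𝒜) :
    ∀ ξ ∈ W, ∀ Y : TDom P.d (L * domCount P M (k + 1)), ∀ z ∈ ball (0 : ((𝔇.𝒦 Z t).Λ → ℂ)) RA,
      ‖Wc Z t ξ Y z‖ ≤ wilsonSupBound M𝒜 Y * (‖z‖ / RA) ^ 3 :=
  fun ξ hξ Y z hz => by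
  rw [h ξ hξ Y z (h𝔅 hz)]
  exact LocActionC.norm_wilsonC_le_cubic hRA hhol h𝔅 hM ξ hξ Y z hz

/-- **★ Transfer (`hWd` VERBATIM): ANALYTICITY IN THE FIELD ON THE BALL of an opaque `Wc` read as the remainder of an action.**
[cite: Balaban1988RG2Cluster, Lemma 2 (1.41) p.11 and (1.34) p.9; Balaban1987RG1, (2.8) p.266] -/
theorem differentiableOn_ball (h : 𝔇.WilsonOfActionOn Wc Z t 𝒜 W 𝔅c) (h𝔅o : IsOpen 𝔅c) (hRA : 0 < RA) (h𝔅 : ball 0 RA ⊆ 𝔅c)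
    (hhol : 𝒜.FieldHoloOn W 𝔅c) :
    ∀ ξ ∈ W, ∀ Y : TDom P.d (L * domCount P M (k + 1)), DifferentiableOn ℂ (Wc Z t ξ Y) (ball 0 RA) :=
  fun ξ hξ Y => (LocActionC.differentiableOn_wilsonC_ball hRA hhol h𝔅o h𝔅 ξ hξ Y).congr fun z hz => h ξ hξ Y z (h𝔅 hz)

/-- Transfer: analyticity in the field on the whole field set. [cite: Balaban1988RG2Cluster, Lemma 2 (1.41) p.11 (bookkeeping)] -/
theorem differentiableOn_field (h : 𝔇.WilsonOfActionOn Wc Z t 𝒜 W 𝔅c) (h𝔅o : IsOpen 𝔅c) (h0 : (0 : (𝔇.𝒦 Z t).Λ → ℂ) ∈ 𝔅c)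
    (hhol : 𝒜.FieldHoloOn W 𝔅c) :
    ∀ ξ ∈ W, ∀ Y : TDom P.d (L * domCount P M (k + 1)), DifferentiableOn ℂ (Wc Z t ξ Y) 𝔅c :=
  fun ξ hξ Y => (LocActionC.differentiableOn_wilsonC_field hhol h𝔅o h0 ξ hξ Y).congr fun z hz => h ξ hξ Y z hz

/-- Transfer: analyticity in the configuration at a complex field of `𝔅c`, from joint analyticity of the action. [cite: Balaban1987RG1, (3.10) p.272; Balaban1988RG2Cluster, p.10 l.30; Chae1985, Thm 14.13] -/
theorem differentiableOn_config [NormedRing 𝔸] [NormedAlgebra ℂ 𝔸] (h : 𝔇.WilsonOfActionOn Wc Z t 𝒜 W 𝔅c) (hW : IsOpen W) (h𝔅o : IsOpen 𝔅c)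
    (h0 : (0 : (𝔇.𝒦 Z t).Λ → ℂ) ∈ 𝔅c) (hj : 𝒜.JointHoloOn W 𝔅c) :
    ∀ Y : TDom P.d (L * domCount P M (k + 1)), ∀ z ∈ 𝔅c, DifferentiableOn ℂ (fun ξ : CPair P 𝔸 => Wc Z t ξ Y z) W :=
  fun Y z hz => (LocActionC.differentiableOn_wilsonC_config hj hW h𝔅o h0 Y z hz).congr fun ξ hξ => h ξ hξ Y z hz

/-- **★ Transfer (`h𝒲d` VERBATIM for `𝒲 := realSliceWilson Wc`): THE REAL SLICE of an opaque `Wc` read as the remainder of a jointly analytic action IS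
ANALYTIC IN THE CONFIGURATION at EVERY real field**, when the field set contains every real field. [cite: Balaban1987RG1, (2.9)-(2.11) pp.266-267 and (3.10) p.272; Balaban1988RG2Cluster, p.10 l.30; Chae1985, Thm 14.13] -/
theorem differentiableOn_config_realSlice [NormedRing 𝔸] [NormedAlgebra ℂ 𝔸] (h : 𝔇.WilsonOfActionOn Wc Z t 𝒜 W 𝔅c) (hW : IsOpen W)
    (h𝔅o : IsOpen 𝔅c) (h𝔅 : ∀ A : (𝔇.𝒦 Z t).Λ → ℝ, ofRealVec A ∈ 𝔅c) (hj : 𝒜.JointHoloOn W 𝔅c) :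
    ∀ (Y : TDom P.d (L * domCount P M (k + 1))) (A : ((𝔇.𝒦 Z t).Λ → ℝ)),
      DifferentiableOn ℂ (fun ξ : CPair P 𝔸 => 𝔇.realSliceWilson Wc Z t ξ Y A) W :=
  fun Y A => (LocActionC.differentiableOn_wilsonC_config_realSlice hj hW h𝔅o h𝔅 Y A).congr fun ξ hξ => h ξ hξ Y (ofRealVec A) (h𝔅 A)

/-- **★ Transfer (`h𝒲m` VERBATIM for `𝒲 := realSliceWilson Wc`): MEASURABILITY OF THE REAL SLICE of an opaque `Wc` read as the remainder of an action**,
on a field set containing every real field, from the measurability law of the action's real slice. [cite: Balaban1988RG2Cluster, Lemma 2 (1.41) p.11; Balaban1987RG1, (2.1) p.265] -/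
theorem measurable_realSlice (h : 𝔇.WilsonOfActionOn Wc Z t 𝒜 W 𝔅c) (h𝔅 : ∀ A : (𝔇.𝒦 Z t).Λ → ℝ, ofRealVec A ∈ 𝔅c) (hRA : 0 < RA)
    (h𝔅R : ball 0 RA ⊆ 𝔅c) (hhol : 𝒜.FieldHoloOn W 𝔅c) (hM : 𝒜.SupBoundOn W RA M𝒜) (hm : 𝒜.RealSliceMeasurable W) :
    ∀ ξ ∈ W, ∀ Y : TDom P.d (L * domCount P M (k + 1)), Measurable (𝔇.realSliceWilson Wc Z t ξ Y) :=
  fun ξ hξ Y => by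
  have e : 𝔇.realSliceWilson Wc Z t ξ Y = fun A => 𝒜.wilsonC ξ Y (ofRealVec A) := funext fun A => h ξ hξ Y (ofRealVec A) (h𝔅 A)
  rw [e]
  exact LocActionC.measurable_wilsonC_realSlice hRA hhol h𝔅R hM hm ξ hξ Y

/-- Transfer (`h𝒲m` shape, continuity route): measurability of the real slice of `Wc` from field analyticity on an open field set containing every real
field. [cite: Balaban1988RG2Cluster, Lemma 2 (1.41) p.11 (bookkeeping)] -/
theorem measurable_realSlice_of_holo (h : 𝔇.WilsonOfActionOn Wc Z t 𝒜 W 𝔅c) (h𝔅o : IsOpen 𝔅c) (h𝔅 : ∀ A : (𝔇.𝒦 Z t).Λ → ℝ, ofRealVec A ∈ 𝔅c)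
    (hhol : 𝒜.FieldHoloOn W 𝔅c) :
    ∀ ξ ∈ W, ∀ Y : TDom P.d (L * domCount P M (k + 1)), Measurable (𝔇.realSliceWilson Wc Z t ξ Y) :=
  fun ξ hξ Y => by
  have e : 𝔇.realSliceWilson Wc Z t ξ Y = fun A => 𝒜.wilsonC ξ Y (ofRealVec A) := funext fun A => h ξ hξ Y (ofRealVec A) (h𝔅 A)
  rw [e]
  exact LocActionC.measurable_wilsonC_realSlice_of_holo hhol h𝔅o h𝔅 ξ hξ Y

/-- **★ Transfer (`hlocY𝒲` VERBATIM for `𝒲 := realSliceWilson Wc`): Y-LOCALITY OF THE REAL SLICE of an opaque `Wc` read as the remainder of a local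
action**, on a field set containing every real field. [cite: Balaban1988RG2Cluster, p.10 l.29 and (1.34) p.9] -/
theorem local_realSlice (h : 𝔇.WilsonOfActionOn Wc Z t 𝒜 W 𝔅c) (h𝔅 : ∀ A : (𝔇.𝒦 Z t).Λ → ℝ, ofRealVec A ∈ 𝔅c) (hloc : 𝒜.LocalInC W S) :
    ∀ ξ ∈ W, ∀ Y ∈ t.1, ∀ A A' : ((𝔇.𝒦 Z t).Λ → ℝ), (∀ b ∈ S Y, A b = A' b) →
      𝔇.realSliceWilson Wc Z t ξ Y A = 𝔇.realSliceWilson Wc Z t ξ Y A' :=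
  fun ξ hξ Y hY A A' hA => by
  rw [𝔇.realSliceWilson_apply, 𝔇.realSliceWilson_apply, h ξ hξ Y _ (h𝔅 A), h ξ hξ Y _ (h𝔅 A')]
  exact LocActionC.wilsonC_local_realSlice hloc ξ hξ Y hY A A' hA

/-- Transfer: Y-locality of `Wc` itself on the field set. [cite: Balaban1988RG2Cluster, p.10 l.29 (bookkeeping)] -/
theorem local_field (h : 𝔇.WilsonOfActionOn Wc Z t 𝒜 W 𝔅c) (hloc : 𝒜.LocalInC W S) :
    ∀ ξ ∈ W, ∀ Y ∈ t.1, ∀ z ∈ 𝔅c, ∀ z' ∈ 𝔅c, (∀ b ∈ S Y, z b = z' b) → Wc Z t ξ Y z = Wc Z t ξ Y z' :=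
  fun ξ hξ Y hY z hz z' hz' hzz => by
  rw [h ξ hξ Y z hz, h ξ hξ Y z' hz']
  exact LocActionC.wilsonC_local hloc ξ hξ Y hY z z' hzz

end WilsonOfActionOn

end TermDatum214

end W1

end Literature.MathematicalPhysics.QuantumFieldTheory.Balaban1983to89.Node00

end
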